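import Literature.Probability.LatticeModels.FKIsingQuadrilateralCrossing
import Literature.Analysis.Complex.HalfPlaneTwoArcHarmonic
import Mathlib.Analysis.InnerProductSpace.Harmonic.Constructions
import Mathlib.Analysis.SpecialFunctions.Complex.Arg
import Mathlib.Analysis.SpecialFunctions.Trigonometric.ArctanDeriv
import Mathlib.Analysis.Convex.Deriv
import Mathlib.Analysis.Complex.UpperHalfPlane.Basic
import HarnessLib

/-!
# The Chelkak–Smirnov quadrilateral crossing theorem (CS12 Thm. 6.1): proof bricks

Sibling proof file of `Literature.Probability.LatticeModels.FKIsingQuadrilateralCrossing`, which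
states D. Chelkak, S. Smirnov, *Universality in the 2D Ising model and conformal invariance of
fermionic observables*, Invent. Math. 189 (2012) 515–580 (arXiv:0910.2045), Thm. 6.1, for the square
lattice, as the named fact `ChelkakSmirnov2012_fkIsingQuadrilateralCrossing`. That theorem is NOT
proved in the tree: its printed proof (loc. cit. §6, pp. 26–28 of the arXiv version) rests on the
theory of s-holomorphic functions (§3: the primitive `H = Im ∫ (F)² dz`, its sub- and super-harmonicity,
the boundary modification trick, the precompactness Thm. 3.12), on the discrete harmonic-measure
estimates of Chelkak–Smirnov, Adv. Math. 228 (2011) (the rectangle exit lemma and the weak Beurling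
estimate used on p. 28), on Carathéodory convergence of the discrete quadrilaterals and on the
uniformisation of the limiting quadrilateral onto a slit strip — none of which the tree has.

This file collects the EXPLICIT layer of that proof, fully proved, in the order of the text:

* **The boundary values `A^δ, C^δ` of the combined observable and `ϰ^δ`** (loc. cit., display after
  (6.6) and eq. (6.7)): for the crossing probability `P` and `Q = 1 - P`,
  `A = (P(√2 P + Q) + Q P) / (P(√2 P + Q) + Q(P + √2 Q))`,
  `C = (P Q + Q(P + √2 Q)) / (same)`; we prove `A² + C² = 1` (`csA_sq_add_csC_sq`, so that
  `ϰ := A² = 1 - C²`), the closed forms `A = P(P + √2 Q)/(P² + √2 P Q + Q²)` (`csA_eq`) and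
  `ϰ(P) = [(t² + √2 t)/(t² + √2 t + 1)]²`, `t = P/(1 - P)` (`csKappa_eq_printed`, the printed
  eq. (6.7)), and that `ϰ` is strictly increasing on `[0, 1]` with `ϰ(0) = 0`, `ϰ(1) = 1`
  (`csKappa_strictMonoOn`, `csKappa_zero`, `csKappa_one`), i.e. the paper's bijection
  `ξ : [0, 1] → [0, 1]`.
* **`p = ϰ⁻¹` is the printed crossing function** (last paragraph of the proof, "`p = ξ⁻¹(u)`, which
  coincides with (6.1)"): `ϰ(p(u)) = u` for `u ∈ [0, 1]` where
  `p = fkIsingCrossingFunction`, `p(u) = √(1 - √(1-u)) / (√(1 - √u) + √(1 - √(1-u)))`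
  (`csKappa_fkIsingCrossingFunction`), and conversely `ϰ(P) = u` forces `P = p(u)`
  (`eq_fkIsingCrossingFunction_of_csKappa_eq`). The key identity is
  `√2 · √(1 - √(1-u)) · √(1 - √u) = √u + √(1-u) - 1`.
* **The half-plane computation** ("the simple calculation for the half-plane `(ℍ; 0, 1-u, 1, ∞)`
  gives `H(z) ≡ u + (1/π)(-arg[z - (1-u)] + u arg z + (1-u) arg[z - 1])`; hence `ϰ(ℍ; 0, 1-u, 1, ∞)
  = u`"): `csHalfPlaneH u` is that function; it is harmonic on the open upper half plane
  (`csHalfPlaneH_harmonicAt`, as the imaginary part of an analytic branch of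
  `u i + (1/π)(-log(z - (1-u)) + u log z + (1-u) log(z-1))`) and has boundary values `0` on the arc
  `(a b) = (0, 1-u)`, `1` on `(b c) = (1-u, 1)` and `u` on `(c d) ∪ (d a) = (1, ∞) ∪ (-∞, 0)`
  (`csHalfPlaneH_tendsto_arc_*`), and tends to `u` at the marked point `d = ∞`
  (`csHalfPlaneH_tendsto_atInfty`), i.e. exactly the boundary values (6.6) of the limit `H`
  with `ϰ = u`.
* A priori bounds used by the compactness wrapper: `P^δ = csCrossingProb ∈ [0, 1]`
  (`DiscreteRect.csCrossingProb_mem_Icc`) and `p(u) ∈ [0, 1]` (`fkIsingCrossingFunction_mem_Icc`),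
  whence the trivial bound `|P^δ - p(η)| ≤ 1`.
* **Layer "D" of the proof in half-plane coordinates** (p. 27: "`H = Im Φ`", "`d` is mapped exactly
  to the tip `iϰ`", and the list of degenerate cases on p. 28), section `HalfPlane` below: the
  two-parameter model functions `csHalfPlaneHk u ϰ = H_{u,ϰ}` (bounded, harmonic, boundary values
  `0 / 1 / ϰ / ϰ` on `(a b) / (b c) / (c d) / (d a)`), the UNIQUENESS of bounded harmonic functions on
  `ℍ` with these boundary values off a finite set (`eq_csHalfPlaneHk_of_tendsto`, by the tree's
  Lindelöf maximum principle `Literature.Analysis.Complex.harmonic_le_of_real_except`), the two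
  banks (`ϰ > u ⇒ H_{u,ϰ} < ϰ` near the part of `(c d)` close to `d`; `ϰ < u ⇒ H_{u,ϰ} > ϰ` near the
  part of `(d a)` close to `d`: `csHalfPlaneHk_lt_kappa`, `kappa_lt_csHalfPlaneHk`, an exact
  elementary argument via Jensen's inequality for `arctan`), hence "`d ↦` tip `⇒ ϰ = u`"
  (`kappa_eq_of_tip`) and the packaged uniqueness theorem
  `kappa_eq_of_harmonic_boundary_values_of_tip` = "`ϰ(ℍ; 0, 1-u, 1, ∞) = u` and the limit is
  `csHalfPlaneH u`".
* Geometry of `Ω^δ`: `csClosure` is compact, `csDomain` is open and bounded with compact closure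
  inside `csClosure` (`DiscreteRect.isCompact_csClosure`, `isOpen_csDomain`, `isBounded_csDomain`, …).
* **Layer "E", the compactness wrapper**: admissible configurations `CSConfig r R t`, the optimal
  `ε(δ) = csEps r R t δ`, continuity of `p` (`continuous_fkIsingCrossingFunction`), and the two
  reductions `chelkakSmirnov2012_of_seq` (Thm. 6.1 follows from its sequential form: along admissible
  sequences with `δ_k → 0`, `P_k → P`, `η_k → η` one has `P = p(η)`) and
  `chelkakSmirnov2012_of_halfPlaneLimit` (… which follows from the existence of the limiting bounded
  harmonic function on `ℍ` with boundary values `0 / 1 / ϰ / ϰ`, `ϰ = csKappa P`, and the two tip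
  conditions, by the `HalfPlane` uniqueness theorem and `p = ξ⁻¹`).

Still absent (the remaining layers of the printed proof): the two-interface loop model and the
four-point observables `F_[cd], F_[ad]` on `DiscreteRect` quadrilaterals with their s-holomorphicity
and corner values (§2.1, §6 p. 26), the precompactness / boundary identification of `H^δ` for four
marked points (§3.12, §5), the discrete Green-formula argument of pp. 27–28 (Rem. 6.3) and the
Carathéodory compactness of marked quadrilaterals uniform in the shape.

No named facts; Mathlib and the tree's `HalfPlaneTwoArcHarmonic` (Lindelöf's principle) only.

## References
* [ChelkakSmirnov2012Ising] D. Chelkak, S. Smirnov, Invent. Math. 189 (2012), §6: Thm. 6.1, eq. (6.1),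
  the displays following (6.6), eq. (6.7) (`ϰ^δ = (A^δ)² = 1 - (C^δ)² = [(t²+√2t)/(t²+√2t+1)]²`),
  the boundary values of the limit `H`, "`H = Im Φ`", "`d` is mapped exactly to the tip", the
  degenerate cases, Rem. 6.3, and the closing half-plane computation of the proof
  (arXiv:0910.2045, pp. 26–28; READ).
* [Conway1978] J. B. Conway, *Functions of One Complex Variable* (1978), Ch. X §1 (Lindelöf's
  maximum principle, via `Literature.Analysis.Complex.HalfPlaneTwoArcHarmonic`).
-/

noncomputable section

open Filter Set Complex
open scoped Topology

namespace Literature.Probability.LatticeModels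

/-! ### The boundary values `A^δ`, `C^δ` and `ϰ^δ = (A^δ)² = 1 - (C^δ)²` -/

/-- **`A^δ`** of Chelkak–Smirnov's proof of Thm. 6.1 (the modulus of the combined four-point
observable `F^δ` at the corner `a^δ`, in units of `(2δ)^{-1/2}`), as a function of the crossing
probability `P = P^δ` and `Q = Q^δ = 1 - P^δ`:
`A = (P(√2 P + Q) + Q P) / (P(√2 P + Q) + Q(P + √2 Q))`.
[cite: ChelkakSmirnov2012Ising, §6, proof of Thm. 6.1 (display after (6.6))] -/
def csA (P Q : ℝ) : ℝ :=
  (P * (Real.sqrt 2 * P + Q) + Q * P) / (P * (Real.sqrt 2 * P + Q) + Q * (P + Real.sqrt 2 * Q))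

/-- **`C^δ`** of Chelkak–Smirnov's proof of Thm. 6.1 (the modulus of `F^δ` at the corner `c^δ`):
`C = (P Q + Q(P + √2 Q)) / (P(√2 P + Q) + Q(P + √2 Q))`.
[cite: ChelkakSmirnov2012Ising, §6, proof of Thm. 6.1 (display after (6.6))] -/
def csC (P Q : ℝ) : ℝ :=
  (P * Q + Q * (P + Real.sqrt 2 * Q)) / (P * (Real.sqrt 2 * P + Q) + Q * (P + Real.sqrt 2 * Q))

/-- **`ϰ^δ = (A^δ)²`**, the common boundary value of `H^δ` on the arcs `(c d)`, `(d a)` (eq. (6.6)),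
as a function of the crossing probability `P = P^δ` (with `Q = 1 - P`); the paper's bijection
`ξ : [0, 1] → [0, 1]`, `ϰ^δ = ξ(P^δ)`. [cite: ChelkakSmirnov2012Ising, §6 eq. (6.7)] -/
def csKappa (P : ℝ) : ℝ :=
  csA P (1 - P) ^ 2

/-- The quadratic form `P² + √2 P Q + Q²` is positive away from the origin
(`2(P² + √2 P Q + Q²) = (√2 P + Q)² + Q²`). [folklore] -/
theorem csQuadForm_pos {P Q : ℝ} (h : P ≠ 0 ∨ Q ≠ 0) :
    0 < P ^ 2 + Real.sqrt 2 * P * Q + Q ^ 2 := by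
  have key : 2 * (P ^ 2 + Real.sqrt 2 * P * Q + Q ^ 2) = (Real.sqrt 2 * P + Q) ^ 2 + Q ^ 2 := by
    linear_combination (-(P ^ 2)) * (Real.sq_sqrt zero_le_two : Real.sqrt 2 ^ 2 = 2)
  by_cases hQ : Q = 0
  · subst hQ
    have hP : P ≠ 0 := h.resolve_right (fun h ↦ h rfl)
    have : 0 < P ^ 2 := by positivity
    simpa using this
  · have : 0 < Q ^ 2 := by positivity
    nlinarith [sq_nonneg (Real.sqrt 2 * P + Q)]

/-- The common denominator of `A^δ` and `C^δ` is `√2 (P² + √2 P Q + Q²)`. [folklore] -/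
theorem csDen_eq (P Q : ℝ) :
    P * (Real.sqrt 2 * P + Q) + Q * (P + Real.sqrt 2 * Q) =
      Real.sqrt 2 * (P ^ 2 + Real.sqrt 2 * P * Q + Q ^ 2) := by
  linear_combination (-(P * Q)) * (Real.sq_sqrt zero_le_two : Real.sqrt 2 ^ 2 = 2)

/-- The common denominator of `A^δ` and `C^δ` is positive away from the origin. [folklore] -/
theorem csDen_pos {P Q : ℝ} (h : P ≠ 0 ∨ Q ≠ 0) :
    0 < P * (Real.sqrt 2 * P + Q) + Q * (P + Real.sqrt 2 * Q) := by
  rw [csDen_eq]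
  exact mul_pos (Real.sqrt_pos.2 two_pos) (csQuadForm_pos h)

/-- **`(A^δ)² + (C^δ)² = 1`**, i.e. `ϰ^δ = (A^δ)² = 1 - (C^δ)²` (eq. (6.7)); valid whenever
`(P, Q) ≠ (0, 0)`. [cite: ChelkakSmirnov2012Ising, §6 eq. (6.7)] -/
theorem csA_sq_add_csC_sq {P Q : ℝ} (h : P ≠ 0 ∨ Q ≠ 0) : csA P Q ^ 2 + csC P Q ^ 2 = 1 := by
  have hD := (csDen_pos h).ne'
  unfold csA csC
  rw [div_pow, div_pow, ← add_div, div_eq_one_iff_eq (pow_ne_zero 2 hD)]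
  linear_combination (-2 * P ^ 2 * Q ^ 2) * (Real.sq_sqrt zero_le_two : Real.sqrt 2 ^ 2 = 2)

/-- Closed form of `A^δ`: `A = P(P + √2 Q) / (P² + √2 P Q + Q²)`.
[cite: ChelkakSmirnov2012Ising, §6 eq. (6.7)] -/
theorem csA_eq {P Q : ℝ} (h : P ≠ 0 ∨ Q ≠ 0) :
    csA P Q = P * (P + Real.sqrt 2 * Q) / (P ^ 2 + Real.sqrt 2 * P * Q + Q ^ 2) := by
  have hX := (csQuadForm_pos h).ne'
  have hD := (csDen_pos h).ne'
  unfold csA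
  rw [div_eq_div_iff hD hX]
  linear_combination (-(P * Q ^ 3)) * (Real.sq_sqrt zero_le_two : Real.sqrt 2 ^ 2 = 2)

/-- Closed form of `C^δ`: `C = Q(√2 P + Q) / (P² + √2 P Q + Q²)`.
[cite: ChelkakSmirnov2012Ising, §6 eq. (6.7)] -/
theorem csC_eq {P Q : ℝ} (h : P ≠ 0 ∨ Q ≠ 0) :
    csC P Q = Q * (Real.sqrt 2 * P + Q) / (P ^ 2 + Real.sqrt 2 * P * Q + Q ^ 2) := by
  have hX := (csQuadForm_pos h).ne'
  have hD := (csDen_pos h).ne'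
  unfold csC
  rw [div_eq_div_iff hD hX]
  linear_combination (-(P ^ 3 * Q)) * (Real.sq_sqrt zero_le_two : Real.sqrt 2 ^ 2 = 2)

/-- `A^δ` in the ratio `t = P/Q`: `A = (t² + √2 t)/(t² + √2 t + 1)` (for `Q ≠ 0`).
[cite: ChelkakSmirnov2012Ising, §6 eq. (6.7)] -/
theorem csA_eq_ratio {P Q : ℝ} (hQ : Q ≠ 0) :
    csA P Q = ((P / Q) ^ 2 + Real.sqrt 2 * (P / Q)) / ((P / Q) ^ 2 + Real.sqrt 2 * (P / Q) + 1) := by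
  have hX := (csQuadForm_pos (Or.inr hQ : P ≠ 0 ∨ Q ≠ 0)).ne'
  rw [csA_eq (Or.inr hQ)]
  have hX' : (P / Q) ^ 2 + Real.sqrt 2 * (P / Q) + 1 ≠ 0 := by
    have : (P / Q) ^ 2 + Real.sqrt 2 * (P / Q) + 1 = (P ^ 2 + Real.sqrt 2 * P * Q + Q ^ 2) / Q ^ 2 := by
      field_simp
    rw [this]
    exact div_ne_zero hX (pow_ne_zero 2 hQ)
  rw [div_eq_div_iff hX hX']
  field_simp

/-- `0 ≤ A^δ` for `P, Q ≥ 0`. [folklore] -/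
theorem csA_nonneg {P Q : ℝ} (hP : 0 ≤ P) (hQ : 0 ≤ Q) : 0 ≤ csA P Q := by
  unfold csA
  have h2 : 0 ≤ Real.sqrt 2 := Real.sqrt_nonneg 2
  positivity

/-- **The printed form of `ϰ^δ`** (eq. (6.7)):
`ϰ(P) = [(t² + √2 t)/(t² + √2 t + 1)]²` with `t = P/(1 - P)`, for `P ≠ 1`.
[cite: ChelkakSmirnov2012Ising, §6 eq. (6.7)] -/
theorem csKappa_eq_printed {P : ℝ} (hP : P ≠ 1) :
    csKappa P = (((P / (1 - P)) ^ 2 + Real.sqrt 2 * (P / (1 - P))) /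
      ((P / (1 - P)) ^ 2 + Real.sqrt 2 * (P / (1 - P)) + 1)) ^ 2 := by
  rw [csKappa, csA_eq_ratio (sub_ne_zero.2 (Ne.symm hP))]

/-- `ϰ = 1 - (C^δ)²` with `Q = 1 - P`. [cite: ChelkakSmirnov2012Ising, §6 eq. (6.7)] -/
theorem csKappa_eq_one_sub_csC_sq (P : ℝ) : csKappa P = 1 - csC P (1 - P) ^ 2 := by
  have h : P ≠ 0 ∨ 1 - P ≠ 0 := by
    by_cases hP : P = 0
    · exact Or.inr (by rw [hP]; norm_num)
    · exact Or.inl hP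
  have key := csA_sq_add_csC_sq h
  unfold csKappa
  linarith

/-- Closed form of `ϰ` on `[0, 1]` (indeed for all `P`):
`ϰ(P) = [P(P + √2(1-P)) / (P² + √2 P(1-P) + (1-P)²)]²`. [cite: ChelkakSmirnov2012Ising, §6 eq. (6.7)] -/
theorem csKappa_eq (P : ℝ) :
    csKappa P = (P * (P + Real.sqrt 2 * (1 - P)) /
      (P ^ 2 + Real.sqrt 2 * P * (1 - P) + (1 - P) ^ 2)) ^ 2 := by
  have h : P ≠ 0 ∨ 1 - P ≠ 0 := by
    by_cases hP : P = 0
    · exact Or.inr (by rw [hP]; norm_num)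
    · exact Or.inl hP
  rw [csKappa, csA_eq h]

/-- `ϰ(0) = 0`. [cite: ChelkakSmirnov2012Ising, §6 (degenerate cases: `ϰ` is `0` or `1`)] -/
theorem csKappa_zero : csKappa 0 = 0 := by
  simp [csKappa_eq]

/-- `ϰ(1) = 1`. [cite: ChelkakSmirnov2012Ising, §6 (degenerate cases: `ϰ` is `0` or `1`)] -/
theorem csKappa_one : csKappa 1 = 1 := by
  simp [csKappa_eq]

/-- The difference formula behind the monotonicity of `A(P) = csA P (1 - P)`:
with `Q = 1 - P`, `Q' = 1 - P'` and `X = P² + √2 P Q + Q²`,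
`Q² X' - Q'² X = (P' - P)(Q P' + Q' P + √2 Q Q')`. [folklore] -/
theorem csQuadForm_cross_sub (P P' : ℝ) :
    (1 - P) ^ 2 * (P' ^ 2 + Real.sqrt 2 * P' * (1 - P') + (1 - P') ^ 2) -
        (1 - P') ^ 2 * (P ^ 2 + Real.sqrt 2 * P * (1 - P) + (1 - P) ^ 2) =
      (P' - P) * ((1 - P) * P' + (1 - P') * P + Real.sqrt 2 * (1 - P) * (1 - P')) := by
  ring

/-- `A(P) = csA P (1 - P) = 1 - (1-P)²/X(P)` is strictly increasing on `[0, 1]`.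
[cite: ChelkakSmirnov2012Ising, §6 ("the bijection `ξ : [0,1] → [0,1]`")] -/
theorem csA_one_sub_strictMonoOn : StrictMonoOn (fun P : ℝ ↦ csA P (1 - P)) (Icc 0 1) := by
  rintro P ⟨hP0, hP1⟩ P' ⟨hP'0, hP'1⟩ hPP'
  have h2 : 0 ≤ Real.sqrt 2 := Real.sqrt_nonneg 2
  have hne : ∀ R : ℝ, R ≠ 0 ∨ 1 - R ≠ 0 := fun R ↦ by
    by_cases hR : R = 0
    · exact Or.inr (by rw [hR]; norm_num)
    · exact Or.inl hR
  have hX : 0 < P ^ 2 + Real.sqrt 2 * P * (1 - P) + (1 - P) ^ 2 := csQuadForm_pos (hne P)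
  have hX' : 0 < P' ^ 2 + Real.sqrt 2 * P' * (1 - P') + (1 - P') ^ 2 := csQuadForm_pos (hne P')
  simp only
  rw [csA_eq (hne P), csA_eq (hne P'), div_lt_div_iff₀ hX hX']
  have key := csQuadForm_cross_sub P P'
  have hpos : 0 < (P' - P) * ((1 - P) * P' + (1 - P') * P + Real.sqrt 2 * (1 - P) * (1 - P')) := by
    apply mul_pos (sub_pos.2 hPP')
    have h1 : 0 < (1 - P) * P' := mul_pos (by linarith) (by linarith)
    have h2' : 0 ≤ (1 - P') * P := mul_nonneg (by linarith) hP0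
    have h3 : 0 ≤ Real.sqrt 2 * (1 - P) * (1 - P') := by
      apply mul_nonneg (mul_nonneg h2 (by linarith)) (by linarith)
    linarith
  -- `num = X - Q²` on both sides, so the claim is `Q'² X < Q² X'`.
  have hnum : P * (P + Real.sqrt 2 * (1 - P)) =
      (P ^ 2 + Real.sqrt 2 * P * (1 - P) + (1 - P) ^ 2) - (1 - P) ^ 2 := by ring
  have hnum' : P' * (P' + Real.sqrt 2 * (1 - P')) =
      (P' ^ 2 + Real.sqrt 2 * P' * (1 - P') + (1 - P') ^ 2) - (1 - P') ^ 2 := by ring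
  rw [hnum, hnum']
  nlinarith [key, hpos, hX, hX']

/-- **`ϰ` is strictly increasing on `[0, 1]`** (so `ξ = ϰ` is a bijection of `[0, 1]` onto
`[ϰ(0), ϰ(1)] = [0, 1]`). [cite: ChelkakSmirnov2012Ising, §6 ("the bijection `ξ : [0,1] → [0,1]`")] -/
theorem csKappa_strictMonoOn : StrictMonoOn csKappa (Icc 0 1) := by
  intro P hP P' hP' hPP'
  have hA : 0 ≤ csA P (1 - P) := csA_nonneg hP.1 (sub_nonneg.2 hP.2)
  have hlt := csA_one_sub_strictMonoOn hP hP' hPP'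
  simp only at hlt
  unfold csKappa
  exact pow_lt_pow_left₀ hlt hA two_ne_zero

/-- `ϰ` maps `[0, 1]` into `[0, 1]`. [cite: ChelkakSmirnov2012Ising, §6 eq. (6.7)] -/
theorem csKappa_mem_Icc {P : ℝ} (hP : P ∈ Icc 0 1) : csKappa P ∈ Icc 0 1 := by
  refine ⟨by unfold csKappa; positivity, ?_⟩
  rcases eq_or_lt_of_le hP.2 with h | h
  · rw [h, csKappa_one]
  · rw [← csKappa_one]
    exact (csKappa_strictMonoOn hP ⟨zero_le_one, le_rfl⟩ h).le

/-! ### `p = ϰ⁻¹`: the printed crossing function inverts `ξ` -/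

/-- `p(u) ∈ [0, 1]` for every real `u` (`p = a/(b + a)` with `a, b ≥ 0`; junk-safe: `0/0 = 0`).
[cite: ChelkakSmirnov2012Ising, Thm. 6.1 eq. (6.1)] -/
theorem fkIsingCrossingFunction_mem_Icc (u : ℝ) : fkIsingCrossingFunction u ∈ Icc 0 1 := by
  unfold fkIsingCrossingFunction
  set a := Real.sqrt (1 - Real.sqrt (1 - u))
  set b := Real.sqrt (1 - Real.sqrt u)
  have ha : 0 ≤ a := Real.sqrt_nonneg _
  have hb : 0 ≤ b := Real.sqrt_nonneg _
  refine ⟨div_nonneg ha (add_nonneg hb ha), ?_⟩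
  rcases eq_or_lt_of_le (add_nonneg hb ha) with h | h
  · rw [← h, div_zero]; exact zero_le_one
  · rw [div_le_one h]; linarith

/-- **The key identity**: for `u ∈ [0, 1]`,
`√2 · √(1 - √(1-u)) · √(1 - √u) = √u + √(1-u) - 1`
(square both sides and use `(√u)² + (√(1-u))² = 1`; both sides are `≥ 0` because
`√u + √(1-u) ≥ 1`). [folklore] -/
theorem sqrt_two_mul_sqrt_mul_sqrt {u : ℝ} (hu : u ∈ Icc 0 1) :
    Real.sqrt 2 * (Real.sqrt (1 - Real.sqrt (1 - u)) * Real.sqrt (1 - Real.sqrt u)) =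
      Real.sqrt u + Real.sqrt (1 - u) - 1 := by
  obtain ⟨hu0, hu1⟩ := hu
  set σ := Real.sqrt u with hσ
  set c := Real.sqrt (1 - u) with hc
  have hσ2 : σ ^ 2 = u := Real.sq_sqrt hu0
  have hc2 : c ^ 2 = 1 - u := Real.sq_sqrt (by linarith)
  have hσ0 : 0 ≤ σ := Real.sqrt_nonneg _
  have hc0 : 0 ≤ c := Real.sqrt_nonneg _
  have hσ1 : σ ≤ 1 := Real.sqrt_le_one.mpr hu1
  have hc1 : c ≤ 1 := Real.sqrt_le_one.mpr (by linarith)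
  set a := Real.sqrt (1 - c) with ha
  set b := Real.sqrt (1 - σ) with hb
  have ha2 : a ^ 2 = 1 - c := Real.sq_sqrt (by linarith)
  have hb2 : b ^ 2 = 1 - σ := Real.sq_sqrt (by linarith)
  have ha0 : 0 ≤ a := Real.sqrt_nonneg _
  have hb0 : 0 ≤ b := Real.sqrt_nonneg _
  have hsc : 1 ≤ σ + c := by nlinarith [mul_nonneg hσ0 hc0]
  have hl : 0 ≤ Real.sqrt 2 * (a * b) := by positivity
  have hr : 0 ≤ σ + c - 1 := by linarith
  rw [← sq_eq_sq₀ hl hr, mul_pow, mul_pow, (Real.sq_sqrt zero_le_two : Real.sqrt 2 ^ 2 = 2), ha2, hb2]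
  linear_combination (-1 : ℝ) * hσ2 + (-1 : ℝ) * hc2

/-- The denominator of `p(u)` is positive for `u ∈ [0, 1]`. [folklore] -/
theorem fkIsingCrossingFunction_den_pos' {u : ℝ} (hu : u ∈ Icc 0 1) :
    0 < Real.sqrt (1 - Real.sqrt u) + Real.sqrt (1 - Real.sqrt (1 - u)) := by
  obtain ⟨hu0, hu1⟩ := hu
  rcases lt_or_ge u 1 with h | h
  · have : Real.sqrt u < 1 := by
      rw [← Real.sqrt_one]; exact Real.sqrt_lt_sqrt hu0 h
    exact add_pos_of_pos_of_nonneg (Real.sqrt_pos.2 (by linarith)) (Real.sqrt_nonneg _)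
  · have hu1' : u = 1 := le_antisymm hu1 h
    subst hu1'
    norm_num

/-- **`p = ξ⁻¹`** (last paragraph of the proof of Thm. 6.1: "`p = ξ⁻¹(u)`, which coincides with
(6.1)"): `ϰ(p(u)) = u` for `u ∈ [0, 1]`, where `p = fkIsingCrossingFunction` is the printed
crossing function and `ϰ = csKappa` the bijection (6.7). With `a = √(1 - √(1-u))`, `b = √(1 - √u)`,
`p = a/(a+b)`: `A(p) = a(a + √2 b)/(a² + √2 a b + b²) = √u / 1` by the key identity.
[cite: ChelkakSmirnov2012Ising, §6, proof of Thm. 6.1 (eq. (6.7) and eq. (6.1))] -/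
theorem csKappa_fkIsingCrossingFunction {u : ℝ} (hu : u ∈ Icc 0 1) :
    csKappa (fkIsingCrossingFunction u) = u := by
  obtain ⟨hu0, hu1⟩ := hu
  have hab := sqrt_two_mul_sqrt_mul_sqrt ⟨hu0, hu1⟩
  have hden := fkIsingCrossingFunction_den_pos' ⟨hu0, hu1⟩
  set σ := Real.sqrt u with hσ
  set c := Real.sqrt (1 - u) with hc
  set a := Real.sqrt (1 - c) with ha
  set b := Real.sqrt (1 - σ) with hb
  have hσ2 : σ ^ 2 = u := Real.sq_sqrt hu0
  have hσ0 : 0 ≤ σ := Real.sqrt_nonneg _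
  have hσ1 : σ ≤ 1 := Real.sqrt_le_one.mpr hu1
  have hc1 : c ≤ 1 := Real.sqrt_le_one.mpr (by linarith)
  have ha2 : a ^ 2 = 1 - c := Real.sq_sqrt (by linarith)
  have hb2 : b ^ 2 = 1 - σ := Real.sq_sqrt (by linarith)
  -- numerator and denominator of `A(p)` after clearing `(a + b)²`:
  have hnum : a * (a + Real.sqrt 2 * b) = σ := by linear_combination ha2 + hab
  have hdn : a ^ 2 + Real.sqrt 2 * a * b + b ^ 2 = 1 := by linear_combination ha2 + hab + hb2
  have hp : fkIsingCrossingFunction u = a / (b + a) := rfl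
  have hq : 1 - a / (b + a) = b / (b + a) := by
    field_simp
    ring
  rw [csKappa_eq, hp, hq]
  have hS : b + a ≠ 0 := hden.ne'
  have h1 : a / (b + a) * (a / (b + a) + Real.sqrt 2 * (b / (b + a))) = σ / (b + a) ^ 2 := by
    rw [← hnum]
    field_simp
  have h2 : (a / (b + a)) ^ 2 + Real.sqrt 2 * (a / (b + a)) * (b / (b + a)) + (b / (b + a)) ^ 2 =
      1 / (b + a) ^ 2 := by
    rw [← hdn]
    field_simp
  rw [h1, h2, div_div_div_cancel_right₀ (pow_ne_zero 2 hS), div_one, hσ2]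

/-- **Uniqueness**: on `[0, 1]`, `ϰ(P) = u` forces `P = p(u)` (`ϰ` is injective on `[0, 1]` and
`p(u) ∈ [0, 1]` is a preimage). So `p(Ω; a, b, c, d) := ξ⁻¹(ϰ(Ω; a, b, c, d))` of the proof IS
`fkIsingCrossingFunction` of the modulus `u`. [cite: ChelkakSmirnov2012Ising, §6, proof of Thm. 6.1] -/
theorem eq_fkIsingCrossingFunction_of_csKappa_eq {P u : ℝ} (hP : P ∈ Icc 0 1) (hu : u ∈ Icc 0 1)
    (h : csKappa P = u) : P = fkIsingCrossingFunction u :=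
  csKappa_strictMonoOn.injOn hP (fkIsingCrossingFunction_mem_Icc u)
    (h.trans (csKappa_fkIsingCrossingFunction hu).symm)

/-! ### The half-plane computation: `H` for `(ℍ; 0, 1-u, 1, ∞)` -/

/-- The analytic function on the upper half plane whose imaginary part is Chelkak–Smirnov's `H`
for the quadrilateral `(ℍ; 0, 1-u, 1, ∞)`:
`G_u(z) = u i + (1/π)(-log(z - (1-u)) + u log z + (1-u) log(z - 1))` (principal branches).
[cite: ChelkakSmirnov2012Ising, §6, end of the proof of Thm. 6.1] -/
def csHalfPlaneG (u : ℝ) (z : ℂ) : ℂ :=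
  u * I + (Real.pi⁻¹ : ℝ) * (-log (z - (1 - u : ℝ)) + u * log z + (1 - u : ℝ) * log (z - 1))

/-- **Chelkak–Smirnov's half-plane function**
`H(z) = u + (1/π)(-arg(z - (1-u)) + u arg z + (1-u) arg(z - 1))`, `z ∈ ℍ`
(defined on all of `ℂ` by the principal `arg`; only its values on the open upper half plane and
their boundary limits matter). [cite: ChelkakSmirnov2012Ising, §6, end of the proof of Thm. 6.1] -/
def csHalfPlaneH (u : ℝ) (z : ℂ) : ℝ :=
  (csHalfPlaneG u z).im

/-- Unfolding: `H(z) = u + π⁻¹ (-arg(z - (1-u)) + u arg z + (1-u) arg(z - 1))`.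
[cite: ChelkakSmirnov2012Ising, §6, end of the proof of Thm. 6.1] -/
theorem csHalfPlaneH_eq (u : ℝ) (z : ℂ) :
    csHalfPlaneH u z =
      u + Real.pi⁻¹ * (-arg (z - (1 - u : ℝ)) + u * arg z + (1 - u) * arg (z - 1)) := by
  simp [csHalfPlaneH, csHalfPlaneG, Complex.log_im]

/-- `G_u` is analytic at every point of the open upper half plane (all three logarithms are taken
at points of the upper half plane, inside the slit plane). [folklore] -/
theorem analyticAt_csHalfPlaneG (u : ℝ) {z : ℂ} (hz : 0 < z.im) : AnalyticAt ℂ (csHalfPlaneG u) z := by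
  have hs : ∀ r : ℝ, z - (r : ℂ) ∈ slitPlane := fun r ↦
    Or.inr (by simpa using hz.ne')
  have h0 : z ∈ slitPlane := by simpa using hs 0
  have h1 : z - 1 ∈ slitPlane := by simpa using hs 1
  have hu : z - ((1 - u : ℝ) : ℂ) ∈ slitPlane := hs (1 - u)
  unfold csHalfPlaneG
  fun_prop (disch := assumption)

/-- **`H` is harmonic on the upper half plane** (the imaginary part of the analytic `G_u`).
[cite: ChelkakSmirnov2012Ising, §6, end of the proof of Thm. 6.1] -/
theorem csHalfPlaneH_harmonicAt (u : ℝ) {z : ℂ} (hz : 0 < z.im) :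
    InnerProductSpace.HarmonicAt (csHalfPlaneH u) z :=
  (analyticAt_csHalfPlaneG u hz).harmonicAt_im

/-- `H` is harmonic on `ℍₒ` as a set. [cite: ChelkakSmirnov2012Ising, §6, end of the proof of Thm. 6.1] -/
theorem csHalfPlaneH_harmonicOnNhd (u : ℝ) :
    InnerProductSpace.HarmonicOnNhd (csHalfPlaneH u) UpperHalfPlane.upperHalfPlaneSet :=
  fun _ hz ↦ csHalfPlaneH_harmonicAt u hz

/-- Boundary behaviour of `arg(z - r)` from the upper half plane at a real point `x < r`: the limit
is `π`. [folklore] -/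
theorem tendsto_arg_sub_of_lt {x r : ℝ} (h : x < r) :
    Tendsto (fun z : ℂ ↦ arg (z - r)) (𝓝[UpperHalfPlane.upperHalfPlaneSet] (x : ℂ)) (𝓝 Real.pi) := by
  have hmap : Tendsto (fun z : ℂ ↦ z - r) (𝓝[UpperHalfPlane.upperHalfPlaneSet] (x : ℂ))
      (𝓝[{w : ℂ | 0 ≤ w.im}] ((x : ℂ) - r)) := by
    refine tendsto_nhdsWithin_of_tendsto_nhds_of_eventually_within _
      ((continuous_sub_right _).tendsto _ |>.mono_left nhdsWithin_le_nhds) ?_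
    filter_upwards [self_mem_nhdsWithin] with z hz
    simp only [sub_im, ofReal_im, sub_zero] at hz ⊢
    exact le_of_lt hz
  have hlim := tendsto_arg_nhdsWithin_im_nonneg_of_re_neg_of_im_zero
    (z := (x : ℂ) - r) (by simpa using h) (by simp)
  exact hlim.comp hmap

/-- Boundary behaviour of `arg(z - r)` from the upper half plane at a real point `x > r`: the limit
is `0`. [folklore] -/
theorem tendsto_arg_sub_of_gt {x r : ℝ} (h : r < x) :
    Tendsto (fun z : ℂ ↦ arg (z - r)) (𝓝[UpperHalfPlane.upperHalfPlaneSet] (x : ℂ)) (𝓝 0) := by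
  have hx : ((x : ℂ) - r) ∈ slitPlane := Or.inl (by simpa using h)
  have hc : ContinuousAt (fun z : ℂ ↦ arg (z - r)) (x : ℂ) :=
    ContinuousAt.comp (g := arg) (f := fun z : ℂ ↦ z - r) (x := (x : ℂ)) (continuousAt_arg hx)
      (continuous_sub_right (r : ℂ)).continuousAt
  have h0 : arg ((x : ℂ) - r) = 0 := by
    rw [← ofReal_sub, arg_ofReal_of_nonneg (by linarith)]
  simpa [h0] using hc.tendsto.mono_left nhdsWithin_le_nhds

/-- The general boundary limit of `H`: if `arg(z - (1-u)) → α`, `arg z → β`, `arg(z - 1) → γ` along a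
filter, then `H → u + π⁻¹(-α + u β + (1-u) γ)`. [folklore] -/
theorem tendsto_csHalfPlaneH_of {u : ℝ} {l : Filter ℂ} {α β γ : ℝ}
    (hα : Tendsto (fun z : ℂ ↦ arg (z - (1 - u : ℝ))) l (𝓝 α))
    (hβ : Tendsto (fun z : ℂ ↦ arg z) l (𝓝 β))
    (hγ : Tendsto (fun z : ℂ ↦ arg (z - 1)) l (𝓝 γ)) :
    Tendsto (csHalfPlaneH u) l (𝓝 (u + Real.pi⁻¹ * (-α + u * β + (1 - u) * γ))) := by
  have : csHalfPlaneH u = fun z ↦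
      u + Real.pi⁻¹ * (-arg (z - (1 - u : ℝ)) + u * arg z + (1 - u) * arg (z - 1)) :=
    funext (csHalfPlaneH_eq u)
  rw [this]
  exact tendsto_const_nhds.add
    (((hα.neg.add (hβ.const_mul u)).add (hγ.const_mul (1 - u))).const_mul _)

/-- **Boundary values on the white arc `(a b) = (0, 1-u)`: `H → 0`.**
[cite: ChelkakSmirnov2012Ising, §6 eq. (6.6) and the end of the proof of Thm. 6.1] -/
theorem csHalfPlaneH_tendsto_arc_ab {u x : ℝ} (hu : 0 ≤ u) (hx0 : 0 < x) (hx1 : x < 1 - u) :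
    Tendsto (csHalfPlaneH u) (𝓝[UpperHalfPlane.upperHalfPlaneSet] (x : ℂ)) (𝓝 0) := by
  have hα := tendsto_arg_sub_of_lt hx1
  have hβ : Tendsto (fun z : ℂ ↦ arg z) (𝓝[UpperHalfPlane.upperHalfPlaneSet] (x : ℂ)) (𝓝 0) := by
    simpa using tendsto_arg_sub_of_gt (r := 0) hx0
  have hγ : Tendsto (fun z : ℂ ↦ arg (z - 1)) (𝓝[UpperHalfPlane.upperHalfPlaneSet] (x : ℂ))
      (𝓝 Real.pi) := by
    simpa using tendsto_arg_sub_of_lt (r := 1) (by linarith)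
  convert tendsto_csHalfPlaneH_of (by simpa using hα) hβ hγ using 2
  field_simp
  ring

/-- **Boundary values on the black arc `(b c) = (1-u, 1)`: `H → 1`.**
[cite: ChelkakSmirnov2012Ising, §6 eq. (6.6) and the end of the proof of Thm. 6.1] -/
theorem csHalfPlaneH_tendsto_arc_bc {u x : ℝ} (hu : u ≤ 1) (hx0 : 1 - u < x) (hx1 : x < 1) :
    Tendsto (csHalfPlaneH u) (𝓝[UpperHalfPlane.upperHalfPlaneSet] (x : ℂ)) (𝓝 1) := by
  have hα := tendsto_arg_sub_of_gt hx0
  have hβ : Tendsto (fun z : ℂ ↦ arg z) (𝓝[UpperHalfPlane.upperHalfPlaneSet] (x : ℂ)) (𝓝 0) := by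
    simpa using tendsto_arg_sub_of_gt (r := 0) (by linarith)
  have hγ : Tendsto (fun z : ℂ ↦ arg (z - 1)) (𝓝[UpperHalfPlane.upperHalfPlaneSet] (x : ℂ))
      (𝓝 Real.pi) := by
    simpa using tendsto_arg_sub_of_lt (r := 1) hx1
  convert tendsto_csHalfPlaneH_of (by simpa using hα) hβ hγ using 2
  field_simp
  ring

/-- **Boundary values on the white arc `(c d) = (1, ∞)`: `H → u = ϰ`.**
[cite: ChelkakSmirnov2012Ising, §6 eq. (6.6) and the end of the proof of Thm. 6.1] -/
theorem csHalfPlaneH_tendsto_arc_cd {u x : ℝ} (hu : 0 ≤ u) (hx : 1 < x) :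
    Tendsto (csHalfPlaneH u) (𝓝[UpperHalfPlane.upperHalfPlaneSet] (x : ℂ)) (𝓝 u) := by
  have hα := tendsto_arg_sub_of_gt (r := 1 - u) (x := x) (by linarith)
  have hβ : Tendsto (fun z : ℂ ↦ arg z) (𝓝[UpperHalfPlane.upperHalfPlaneSet] (x : ℂ)) (𝓝 0) := by
    simpa using tendsto_arg_sub_of_gt (r := 0) (by linarith)
  have hγ : Tendsto (fun z : ℂ ↦ arg (z - 1)) (𝓝[UpperHalfPlane.upperHalfPlaneSet] (x : ℂ))
      (𝓝 0) := by
    simpa using tendsto_arg_sub_of_gt (r := 1) hx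
  convert tendsto_csHalfPlaneH_of (by simpa using hα) hβ hγ using 2
  ring

/-- **Boundary values on the black arc `(d a) = (-∞, 0)`: `H → u = ϰ`.**
[cite: ChelkakSmirnov2012Ising, §6 eq. (6.6) and the end of the proof of Thm. 6.1] -/
theorem csHalfPlaneH_tendsto_arc_da {u x : ℝ} (hu : u ≤ 1) (hx : x < 0) :
    Tendsto (csHalfPlaneH u) (𝓝[UpperHalfPlane.upperHalfPlaneSet] (x : ℂ)) (𝓝 u) := by
  have hα := tendsto_arg_sub_of_lt (r := 1 - u) (x := x) (by linarith)
  have hβ : Tendsto (fun z : ℂ ↦ arg z) (𝓝[UpperHalfPlane.upperHalfPlaneSet] (x : ℂ))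
      (𝓝 Real.pi) := by
    simpa using tendsto_arg_sub_of_lt (r := 0) hx
  have hγ : Tendsto (fun z : ℂ ↦ arg (z - 1)) (𝓝[UpperHalfPlane.upperHalfPlaneSet] (x : ℂ))
      (𝓝 Real.pi) := by
    simpa using tendsto_arg_sub_of_lt (r := 1) (by linarith)
  convert tendsto_csHalfPlaneH_of (by simpa using hα) hβ hγ using 2
  field_simp
  ring

/-! #### The marked point `d = ∞`: `H → u` -/

/-- For `x, y` in the open upper half plane, `arg (x / y) = arg x - arg y` (both arguments lie
in `[0, π)`, so no branch correction occurs). [folklore] -/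
theorem arg_div_eq_arg_sub_arg_of_im_pos {x y : ℂ} (hx : 0 < x.im) (hy : 0 < y.im) :
    arg (x / y) = arg x - arg y := by
  have hx0 : x ≠ 0 := fun h ↦ by simp [h] at hx
  have hy0 : y ≠ 0 := fun h ↦ by simp [h] at hy
  have h := arg_div_coe_angle hx0 hy0
  rw [← Real.Angle.coe_sub] at h
  have hb : -Real.pi < arg x - arg y ∧ arg x - arg y ≤ Real.pi := by
    have h1 := arg_nonneg_iff.2 hx.le
    have h2 := arg_nonneg_iff.2 hy.le
    have h3 := arg_lt_pi_iff.2 (Or.inr hx.ne')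
    have h4 := arg_lt_pi_iff.2 (Or.inr hy.ne')
    constructor <;> linarith
  rw [← arg_coe_angle_toReal_eq_arg, h, Real.Angle.toReal_coe_eq_self_iff.2 hb]

/-- `c / (z - a) → 0` as `z → ∞` in `ℂ`. [folklore] -/
theorem tendsto_const_div_sub_cocompact (c a : ℂ) :
    Tendsto (fun z : ℂ ↦ c / (z - a)) (cocompact ℂ) (𝓝 0) := by
  have h1 : Tendsto (fun z : ℂ ↦ ‖z - a‖) (cocompact ℂ) atTop := by
    refine tendsto_atTop_mono (fun z ↦ ?_)
      (tendsto_atTop_add_const_right _ (-‖a‖) tendsto_norm_cocompact_atTop)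
    simpa [sub_eq_add_neg] using norm_sub_norm_le z a
  have h2 : Tendsto (fun z : ℂ ↦ ‖z - a‖⁻¹) (cocompact ℂ) (𝓝 0) := h1.inv_tendsto_atTop
  rw [tendsto_zero_iff_norm_tendsto_zero]
  have : (fun z : ℂ ↦ ‖c / (z - a)‖) = fun z ↦ ‖c‖ * ‖z - a‖⁻¹ := by
    funext z
    rw [norm_div, div_eq_mul_inv]
  rw [this]
  simpa using h2.const_mul ‖c‖

/-- `(z - b)/(z - a) → 1` as `z → ∞` within the upper half plane (`a, b` real).
[folklore] -/
theorem tendsto_sub_div_sub_atInfty (a b : ℝ) :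
    Tendsto (fun z : ℂ ↦ (z - b) / (z - a))
      (cocompact ℂ ⊓ 𝓟 UpperHalfPlane.upperHalfPlaneSet) (𝓝 1) := by
  have key : ∀ z : ℂ, 0 < z.im → (z - b) / (z - a) = 1 + ((a : ℂ) - b) / (z - a) := by
    intro z hz
    have hza : z - a ≠ 0 := by
      intro h
      have := congrArg Complex.im h
      simp at this
      exact hz.ne' this
    field_simp
    ring
  have h0 : Tendsto (fun z : ℂ ↦ 1 + ((a : ℂ) - b) / (z - a))
      (cocompact ℂ ⊓ 𝓟 UpperHalfPlane.upperHalfPlaneSet) (𝓝 (1 + 0)) :=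
    tendsto_const_nhds.add ((tendsto_const_div_sub_cocompact _ _).mono_left inf_le_left)
  rw [add_zero] at h0
  refine h0.congr' ?_
  rw [EventuallyEq, eventually_inf_principal]
  exact Eventually.of_forall fun z hz ↦ (key z hz).symm

/-- The angle subtended by the real segment `[a, b]` vanishes at infinity:
`arg(z - b) - arg(z - a) → 0` as `z → ∞` within the upper half plane. [folklore] -/
theorem tendsto_arg_sub_sub_arg_sub_atInfty (a b : ℝ) :
    Tendsto (fun z : ℂ ↦ arg (z - b) - arg (z - a))
      (cocompact ℂ ⊓ 𝓟 UpperHalfPlane.upperHalfPlaneSet) (𝓝 0) := by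
  have h1 : Tendsto (fun z : ℂ ↦ arg ((z - b) / (z - a)))
      (cocompact ℂ ⊓ 𝓟 UpperHalfPlane.upperHalfPlaneSet) (𝓝 0) := by
    have hc : ContinuousAt arg 1 := continuousAt_arg (Or.inl (by simp))
    have := hc.tendsto.comp (tendsto_sub_div_sub_atInfty a b)
    rwa [arg_one] at this
  refine h1.congr' ?_
  rw [EventuallyEq, eventually_inf_principal]
  refine Eventually.of_forall fun z hz ↦ ?_
  have hz' : 0 < z.im := hz
  exact arg_div_eq_arg_sub_arg_of_im_pos (by simpa using hz') (by simpa using hz')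

/-- **Boundary value at the marked point `d = ∞`: `H → u = ϰ`** as `z → ∞` within the upper
half plane (write `H - u = π⁻¹ [u (arg z - arg(z - (1-u))) + (1-u)(arg(z-1) - arg(z - (1-u)))]`,
two vanishing subtended angles). [cite: ChelkakSmirnov2012Ising, §6, end of the proof of Thm. 6.1
("`d` is mapped to the tip", `ϰ(ℍ; 0, 1-u, 1, ∞) = u`)] -/
theorem csHalfPlaneH_tendsto_atInfty (u : ℝ) :
    Tendsto (csHalfPlaneH u) (cocompact ℂ ⊓ 𝓟 UpperHalfPlane.upperHalfPlaneSet) (𝓝 u) := by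
  have hA : Tendsto (fun z : ℂ ↦ arg z - arg (z - (1 - u : ℝ)))
      (cocompact ℂ ⊓ 𝓟 UpperHalfPlane.upperHalfPlaneSet) (𝓝 0) := by
    simpa using tendsto_arg_sub_sub_arg_sub_atInfty (1 - u) 0
  have hB : Tendsto (fun z : ℂ ↦ arg (z - 1) - arg (z - (1 - u : ℝ)))
      (cocompact ℂ ⊓ 𝓟 UpperHalfPlane.upperHalfPlaneSet) (𝓝 0) := by
    simpa using tendsto_arg_sub_sub_arg_sub_atInfty (1 - u) 1
  have h := (tendsto_const_nhds : Tendsto (fun _ : ℂ ↦ u) _ (𝓝 u)).add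
    (((hA.const_mul u).add (hB.const_mul (1 - u))).const_mul Real.pi⁻¹)
  simp only [mul_zero, add_zero] at h
  refine h.congr fun z ↦ ?_
  rw [csHalfPlaneH_eq]
  ring

/-! ### A priori bounds: `P^δ ∈ [0, 1]`, `|P^δ - p| ≤ 1` -/

namespace DiscreteRect

variable (E : Finset (Sym2 (Site 2))) (d₀ : Site 2 × Fin 4) (n : Fin 4 → ℕ)

/-- **`P^δ ∈ [0, 1]`**: the loop-symmetric crossing probability `N/(N + √2 (Z - N))` lies in
`[0, 1]`, since `0 ≤ N(√2) ≤ Z(√2)` (both are sums of powers of `√2`, `N` over fewer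
configurations). [cite: ChelkakSmirnov2012Ising, §6 (`P^δ`, a probability)] -/
theorem csCrossingProb_mem_Icc : csCrossingProb E d₀ n ∈ Icc 0 1 := by
  classical
  unfold csCrossingProb
  set B₀ : Set ↥((verts E : Finset (Site 2)) : Set (Site 2)) := {x | x.1 ∈ blackVerts E d₀ n 0}
  set B₂ : Set ↥((verts E : Finset (Site 2)) : Set (Site 2)) := {x | x.1 ∈ blackVerts E d₀ n 2}
  set N : ℝ := Polynomial.aeval (Real.sqrt 2)
    (rcArcPolynomialIn (graph E) (arcCrossing B₀ B₂) B₀ B₂ .joint) with hN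
  set Z : ℝ := Polynomial.aeval (Real.sqrt 2) (rcArcPolynomial (graph E) B₀ B₂ .joint) with hZ
  have h2 : 0 ≤ Real.sqrt 2 := Real.sqrt_nonneg 2
  have hN0 : 0 ≤ N := by
    rw [hN, aeval_rcArcPolynomialIn]
    exact Finset.sum_nonneg fun _ _ ↦ pow_nonneg h2 _
  have hNZ : N ≤ Z := by
    rw [hN, hZ, aeval_rcArcPolynomialIn, aeval_rcArcPolynomial]
    exact Finset.sum_le_sum_of_subset_of_nonneg (Finset.filter_subset _ _)
      fun _ _ _ ↦ pow_nonneg h2 _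
  have hD : N ≤ N + Real.sqrt 2 * (Z - N) := by nlinarith
  simp only
  refine ⟨div_nonneg hN0 (hN0.trans hD), ?_⟩
  rcases eq_or_lt_of_le (hN0.trans hD) with h | h
  · rw [← h, div_zero]; exact zero_le_one
  · exact (div_le_one h).2 hD

/-- The trivial a priori bound `|P^δ - p(η)| ≤ 1` (both quantities lie in `[0, 1]`): the
`ε(δ) ≤ 1` floor of the compactness argument. [folklore] -/
theorem abs_csCrossingProb_sub_fkIsingCrossingFunction_le_one (η : ℝ) :
    |csCrossingProb E d₀ n - fkIsingCrossingFunction η| ≤ 1 := by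
  have h1 := csCrossingProb_mem_Icc E d₀ n
  have h2 := fkIsingCrossingFunction_mem_Icc η
  rw [abs_le]
  constructor <;> linarith [h1.1, h1.2, h2.1, h2.2]

end DiscreteRect

/-! ### Layer D of the printed proof in half-plane coordinates: "`H = Im Φ`" and "`d ↦` the tip"

After the (Carathéodory) passage to the limit, the printed proof (loc. cit. p. 27 of the arXiv
version) argues in the limiting quadrilateral `(Ω; a, b, c, d)`: the limit `H` of the `H^δ` is
harmonic, bounded, `H = 0` on `(a b)`, `H = 1` on `(b c)`, `H = ϰ` on `(c d) ∪ (d a)`; "the imaginary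
part of `Φ` [the slit-strip map] is harmonic and has the same boundary values as `H`, so we conclude
that `H = Im Φ`"; and "`d` is mapped exactly to the tip `iϰ`": if `d` were on the lower bank then
`H < ϰ` near a part of `(c d)` close to `d`, if on the upper bank (or `ϰ = 0`) then `H > ϰ` near a
part of `(d a)`, both excluded by the discrete Green-formula argument of pp. 27–28 (Rem. 6.3); and
finally `ϰ(ℍ; 0, 1-u, 1, ∞) = u` by the explicit `H`. We prove the continuum half of this in the
coordinates of the tree's statement, i.e. on `ℍ` with `(a, b, c, d) = (0, 1-u, 1, ∞)`:

* `csHalfPlaneHk u ϰ` is the bounded harmonic function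
  `H_{u,ϰ}(z) = ϰ + π⁻¹((1-ϰ) arg(z-1) - arg(z-(1-u)) + ϰ arg z) = ω_{(1-u,1)} + ϰ (ω_{(1,∞)} + ω_{(-∞,0)})`
  with boundary values `0 / 1 / ϰ / ϰ` on the four arcs (`csHalfPlaneHk_tendsto_arc_*`), and
  `H_{u,u} = csHalfPlaneH u` (`csHalfPlaneHk_self`);
* **uniqueness** (`eq_csHalfPlaneHk_of_tendsto`, the "`H = Im Φ`" step): a bounded harmonic
  function on `ℍ` with these boundary values outside a finite set of real points (nothing assumed
  at the marked points, nor at `d = ∞`) IS `H_{u,ϰ}` — by Lindelöf's maximum principle on `ℍ`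
  (`Literature.Analysis.Complex.harmonic_le_of_real_except`);
* **the two banks** (`csHalfPlaneHk_lt_kappa`, `kappa_lt_csHalfPlaneHk`): if `ϰ > u` then
  `H_{u,ϰ} < ϰ` on `{Re z > max(1, ϰ(1-u)/(ϰ-u))}` (a neighbourhood in `ℍ` of the part of `(c d)`
  close to `d`), and if `ϰ < u` then `H_{u,ϰ} > ϰ` on `{Re z < -max(0, ϰ(1-u)/(u-ϰ))}` (near the
  part of `(d a)` close to `d`). The proof is elementary and exact: for `Re z = x > 1`,
  `H_{u,ϰ} - ϰ = π⁻¹((1-ϰ) arctan(y/(x-1)) + ϰ arctan(y/x) - arctan(y/(x-1+u)))`, Jensen's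
  inequality for the concave `arctan` on `[0, ∞)` bounds the weighted sum by
  `arctan(y[(1-ϰ)/(x-1) + ϰ/x])`, and `(1-ϰ)/(x-1) + ϰ/x < 1/(x-1+u) ⟺ (u-ϰ) x + ϰ(1-u) < 0`;
  symmetrically on the left;
* hence **`d ↦` tip forces `ϰ = u`** (`kappa_eq_of_tip`) and the packaged statement
  `kappa_eq_of_harmonic_boundary_values_of_tip`: a bounded harmonic `v` on `ℍ` with the boundary
  values `0 / 1 / ϰ / ϰ` off a finite set which is not eventually `< ϰ` towards `d` along `(c d)` nor
  eventually `> ϰ` towards `d` along `(d a)` has `ϰ = u` and `v = csHalfPlaneH u` — this is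
  "`ϰ(ℍ; 0, 1-u, 1, ∞) = u`". The cases `u = 0` (`b = c`) and `u = 1` (`a = b`) of the list of
  degenerate cases on p. 28 are included (`u ∈ [0, 1]` throughout).
-/

section HalfPlane

open UpperHalfPlane (upperHalfPlaneSet)
open InnerProductSpace (HarmonicOnNhd HarmonicAt)

/-- **Lindelöf uniqueness on `ℍ`**: a bounded harmonic function on the upper half plane tending
to `0` at every real boundary point outside a finite set vanishes identically (the maximum
principle `harmonic_le_of_real_except` applied to `±d`; the point at infinity needs no hypothesis).
[cite: Conway1978, Ch. X §1; used in ChelkakSmirnov2012Ising, §6 ("so we conclude that H = Im Φ")] -/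
theorem harmonic_eq_zero_of_tendsto_real_except {d : ℂ → ℝ} (hd : HarmonicOnNhd d upperHalfPlaneSet)
    {B : ℝ} (hB : ∀ z ∈ upperHalfPlaneSet, |d z| ≤ B) (E : Finset ℝ)
    (hlim : ∀ x : ℝ, x ∉ E → Tendsto d (𝓝[upperHalfPlaneSet] (x : ℂ)) (𝓝 0)) :
    ∀ z ∈ upperHalfPlaneSet, d z = 0 := by
  have hle : ∀ (f : ℂ → ℝ), HarmonicOnNhd f upperHalfPlaneSet →
      (∀ z ∈ upperHalfPlaneSet, |f z| ≤ B) →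
      (∀ x : ℝ, x ∉ E → Tendsto f (𝓝[upperHalfPlaneSet] (x : ℂ)) (𝓝 0)) →
      ∀ z ∈ upperHalfPlaneSet, f z ≤ 0 := by
    intro f hf hfb hfl
    refine Literature.Analysis.Complex.harmonic_le_of_real_except hf (B := B)
      (fun z hz ↦ (le_abs_self _).trans (hfb z hz)) E ?_
    intro x hx ε hε
    have hev : ∀ᶠ z in 𝓝[upperHalfPlaneSet] (x : ℂ), f z < 0 + ε :=
      hfl x hx (Iio_mem_nhds (by linarith : (0 : ℝ) < 0 + ε))
    exact hev.mono fun z hz ↦ hz.le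
  intro z hz
  have h1 := hle d hd hB hlim z hz
  have h2 := hle (fun w ↦ -d w) hd.neg (fun w hw ↦ by rw [abs_neg]; exact hB w hw)
    (fun x hx ↦ by simpa using (hlim x hx).neg) z hz
  linarith

/-- `arg (z - t) = arctan (Im z / (Re z - t))` for real `t < Re z` (the open right half plane
translated by `t`). [folklore] -/
theorem arg_sub_ofReal_eq_arctan {z : ℂ} {t : ℝ} (h : t < z.re) :
    arg (z - t) = Real.arctan (z.im / (z.re - t)) := by
  have hre : 0 < (z - t).re := by simp; linarith
  have h1 : |arg (z - t)| < Real.pi / 2 := abs_arg_lt_pi_div_two_iff.2 (Or.inl hre)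
  rw [abs_lt] at h1
  have h2 := Real.arctan_tan h1.1 h1.2
  rw [tan_arg] at h2
  rw [← h2]
  congr 1
  simp

/-- `arg (z - t) = π - arctan (Im z / (t - Re z))` for `z ∈ ℍ` and real `t > Re z` (the open
second quadrant translated by `t`). [folklore] -/
theorem arg_sub_ofReal_eq_pi_sub_arctan {z : ℂ} {t : ℝ} (h : z.re < t) (hz : 0 < z.im) :
    arg (z - t) = Real.pi - Real.arctan (z.im / (t - z.re)) := by
  have him : 0 < (z - t).im := by simpa using hz
  have h1 : arg (-(z - t)) = arg (z - t) - Real.pi := arg_neg_eq_arg_sub_pi_of_im_pos him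
  have hneg : -(z - (t : ℂ)) = (t : ℂ) - z := by ring
  have hre : 0 < ((t : ℂ) - z).re := by simp; linarith
  have h3 : |arg ((t : ℂ) - z)| < Real.pi / 2 := abs_arg_lt_pi_div_two_iff.2 (Or.inl hre)
  rw [abs_lt] at h3
  have h4 := Real.arctan_tan h3.1 h3.2
  rw [tan_arg] at h4
  have h5 : ((t : ℂ) - z).im / ((t : ℂ) - z).re = -(z.im / (t - z.re)) := by
    simp [neg_div]
  rw [h5, Real.arctan_neg] at h4
  rw [hneg] at h1
  linarith

/-- `arctan` is concave on `[0, ∞)` (its derivative `1/(1+x²)` is decreasing there). [folklore] -/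
theorem concaveOn_arctan_Ici : ConcaveOn ℝ (Ici (0 : ℝ)) Real.arctan := by
  refine AntitoneOn.concaveOn_of_deriv (convex_Ici 0) Real.continuous_arctan.continuousOn
    Real.differentiable_arctan.differentiableOn ?_
  rw [interior_Ici, Real.deriv_arctan]
  intro x hx y hy hxy
  have hx' : 0 < x := hx
  have hy' : 0 < y := hy
  show 1 / (1 + y ^ 2) ≤ 1 / (1 + x ^ 2)
  apply one_div_le_one_div_of_le (by positivity)
  nlinarith

/-- The core comparison behind the two banks: for weights `1 - ϰ, ϰ` (`ϰ ∈ [0, 1]`) and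
`A, B ≥ 0`, `(1-ϰ) arctan A + ϰ arctan B ≤ arctan((1-ϰ) A + ϰ B) < arctan C` as soon as
`(1-ϰ) A + ϰ B < C` (Jensen's inequality for the concave `arctan` on `[0, ∞)`, then strict
monotonicity). [folklore] -/
theorem weighted_arctan_lt {ϰ A B C : ℝ} (hϰ : ϰ ∈ Icc 0 1) (hA : 0 ≤ A) (hB : 0 ≤ B)
    (h : (1 - ϰ) * A + ϰ * B < C) :
    (1 - ϰ) * Real.arctan A + ϰ * Real.arctan B < Real.arctan C := by
  obtain ⟨h0, h1⟩ := hϰ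
  have hmA : A ∈ Ici (0 : ℝ) := hA
  have hmB : B ∈ Ici (0 : ℝ) := hB
  have hJ := concaveOn_arctan_Ici.2 hmA hmB (by linarith : (0 : ℝ) ≤ 1 - ϰ) h0
    (by ring : 1 - ϰ + ϰ = 1)
  simp only [smul_eq_mul] at hJ
  exact hJ.trans_lt (Real.arctan_strictMono h)

/-- **The model harmonic functions `H_{u,ϰ}` on `(ℍ; 0, 1-u, 1, ∞)`**:
`H_{u,ϰ}(z) = ϰ + π⁻¹ ((1-ϰ) arg(z-1) - arg(z-(1-u)) + ϰ arg z)`, i.e.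
`ω(z; (1-u, 1)) + ϰ [ω(z; (1, ∞)) + ω(z; (-∞, 0))]` written out with `ω(z; (α, β)) =
(arg(z-β) - arg(z-α))/π`: the bounded harmonic function with boundary values `0` on `(a b)`, `1`
on `(b c)` and `ϰ` on `(c d) ∪ (d a)` — the imaginary part of the slit-strip map `Φ` with slit
height `ϰ` (loc. cit.: "`H = Im Φ`"); `H_{u,u}` is Chelkak–Smirnov's `H` (`csHalfPlaneHk_self`).
[cite: ChelkakSmirnov2012Ising, §6, proof of Thm. 6.1 (boundary values of the limit `H`; "`H = Im Φ`")] -/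
def csHalfPlaneHk (u ϰ : ℝ) (z : ℂ) : ℝ :=
  ϰ + Real.pi⁻¹ * ((1 - ϰ) * arg (z - 1) - arg (z - (1 - u : ℝ)) + ϰ * arg z)

/-- `H_{u,u} = H` (the case "`d` at the tip"). [cite: ChelkakSmirnov2012Ising, §6, end of the proof
of Thm. 6.1] -/
theorem csHalfPlaneHk_self (u : ℝ) : csHalfPlaneHk u u = csHalfPlaneH u := by
  funext z
  rw [csHalfPlaneH_eq, csHalfPlaneHk]
  ring

/-- `H_{u,ϰ}` is harmonic on the upper half plane. [folklore] -/
theorem csHalfPlaneHk_harmonicOnNhd (u ϰ : ℝ) :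
    HarmonicOnNhd (csHalfPlaneHk u ϰ) upperHalfPlaneSet := by
  have h1 := Literature.Analysis.Complex.harmonicOnNhd_arg_sub_ofReal 1
  have hu := Literature.Analysis.Complex.harmonicOnNhd_arg_sub_ofReal (1 - u)
  have h0 : HarmonicOnNhd (fun w : ℂ ↦ arg w) upperHalfPlaneSet := by
    simpa using Literature.Analysis.Complex.harmonicOnNhd_arg_sub_ofReal 0
  have hc : HarmonicOnNhd (fun _ : ℂ ↦ ϰ) upperHalfPlaneSet :=
    fun z _ ↦ InnerProductSpace.harmonicAt_const ϰ
  have h := hc.add ((((h1.const_smul (c := 1 - ϰ)).sub hu).add (h0.const_smul (c := ϰ))).const_smul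
    (c := Real.pi⁻¹))
  have heq : csHalfPlaneHk u ϰ = (fun _ : ℂ ↦ ϰ) + Real.pi⁻¹ •
      (((1 - ϰ) • (fun w : ℂ ↦ arg (w - (1 : ℝ))) - fun w : ℂ ↦ arg (w - (1 - u : ℝ))) +
        ϰ • fun w : ℂ ↦ arg w) := by
    funext z
    simp only [csHalfPlaneHk, Pi.add_apply, Pi.smul_apply, Pi.sub_apply, smul_eq_mul, ofReal_one]
  rw [heq]
  exact h

/-- `|H_{u,ϰ}| ≤ 4` (on all of `ℂ`) for `ϰ ∈ [0, 1]`: the limit functions are bounded. [folklore] -/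
theorem abs_csHalfPlaneHk_le {u ϰ : ℝ} (hϰ : ϰ ∈ Icc 0 1) (z : ℂ) : |csHalfPlaneHk u ϰ z| ≤ 4 := by
  obtain ⟨h0, h1⟩ := hϰ
  have hπ := Real.pi_pos
  have hπ3 : (3 : ℝ) < Real.pi := Real.pi_gt_three
  have ha := abs_arg_le_pi (z - 1)
  have hb := abs_arg_le_pi (z - (1 - u : ℝ))
  have hc := abs_arg_le_pi z
  rw [abs_le] at ha hb hc ⊢
  unfold csHalfPlaneHk
  have key : |Real.pi⁻¹ * ((1 - ϰ) * arg (z - 1) - arg (z - (1 - u : ℝ)) + ϰ * arg z)| ≤ 2 := by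
    rw [abs_mul, abs_of_pos (inv_pos.2 hπ)]
    have : |(1 - ϰ) * arg (z - 1) - arg (z - (1 - u : ℝ)) + ϰ * arg z| ≤ 2 * Real.pi := by
      rw [abs_le]
      constructor <;> nlinarith
    calc Real.pi⁻¹ * |(1 - ϰ) * arg (z - 1) - arg (z - (1 - u : ℝ)) + ϰ * arg z|
        ≤ Real.pi⁻¹ * (2 * Real.pi) := by gcongr
      _ = 2 := by field_simp
  rw [abs_le] at key
  constructor <;> linarith [key.1, key.2]

/-- The general boundary limit of `H_{u,ϰ}`: if `arg(z - (1-u)) → α`, `arg z → β`, `arg(z-1) → γ`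
along a filter, then `H_{u,ϰ} → ϰ + π⁻¹((1-ϰ) γ - α + ϰ β)`. [folklore] -/
theorem tendsto_csHalfPlaneHk_of {u ϰ : ℝ} {l : Filter ℂ} {α β γ : ℝ}
    (hα : Tendsto (fun z : ℂ ↦ arg (z - (1 - u : ℝ))) l (𝓝 α))
    (hβ : Tendsto (fun z : ℂ ↦ arg z) l (𝓝 β))
    (hγ : Tendsto (fun z : ℂ ↦ arg (z - 1)) l (𝓝 γ)) :
    Tendsto (csHalfPlaneHk u ϰ) l (𝓝 (ϰ + Real.pi⁻¹ * ((1 - ϰ) * γ - α + ϰ * β))) :=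
  tendsto_const_nhds.add ((((hγ.const_mul (1 - ϰ)).sub hα).add (hβ.const_mul ϰ)).const_mul _)

/-- **Boundary values of `H_{u,ϰ}` on `(a b) = (0, 1-u)`: `0`.**
[cite: ChelkakSmirnov2012Ising, §6, proof of Thm. 6.1 (boundary values of the limit `H`)] -/
theorem csHalfPlaneHk_tendsto_arc_ab {u ϰ x : ℝ} (hu : 0 ≤ u) (hx0 : 0 < x) (hx1 : x < 1 - u) :
    Tendsto (csHalfPlaneHk u ϰ) (𝓝[upperHalfPlaneSet] (x : ℂ)) (𝓝 0) := by
  have hα := tendsto_arg_sub_of_lt hx1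
  have hβ : Tendsto (fun z : ℂ ↦ arg z) (𝓝[upperHalfPlaneSet] (x : ℂ)) (𝓝 0) := by
    simpa using tendsto_arg_sub_of_gt (r := 0) hx0
  have hγ : Tendsto (fun z : ℂ ↦ arg (z - 1)) (𝓝[upperHalfPlaneSet] (x : ℂ)) (𝓝 Real.pi) := by
    simpa using tendsto_arg_sub_of_lt (r := 1) (by linarith)
  convert tendsto_csHalfPlaneHk_of (by simpa using hα) hβ hγ using 2
  field_simp
  ring

/-- **Boundary values of `H_{u,ϰ}` on `(b c) = (1-u, 1)`: `1`.**
[cite: ChelkakSmirnov2012Ising, §6, proof of Thm. 6.1 (boundary values of the limit `H`)] -/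
theorem csHalfPlaneHk_tendsto_arc_bc {u ϰ x : ℝ} (hu : u ≤ 1) (hx0 : 1 - u < x) (hx1 : x < 1) :
    Tendsto (csHalfPlaneHk u ϰ) (𝓝[upperHalfPlaneSet] (x : ℂ)) (𝓝 1) := by
  have hα := tendsto_arg_sub_of_gt hx0
  have hβ : Tendsto (fun z : ℂ ↦ arg z) (𝓝[upperHalfPlaneSet] (x : ℂ)) (𝓝 0) := by
    have : (0 : ℝ) < x := by linarith
    simpa using tendsto_arg_sub_of_gt (r := 0) this
  have hγ : Tendsto (fun z : ℂ ↦ arg (z - 1)) (𝓝[upperHalfPlaneSet] (x : ℂ)) (𝓝 Real.pi) := by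
    simpa using tendsto_arg_sub_of_lt (r := 1) hx1
  convert tendsto_csHalfPlaneHk_of (by simpa using hα) hβ hγ using 2
  field_simp
  ring

/-- **Boundary values of `H_{u,ϰ}` on `(c d) = (1, ∞)`: `ϰ`.**
[cite: ChelkakSmirnov2012Ising, §6, proof of Thm. 6.1 (boundary values of the limit `H`)] -/
theorem csHalfPlaneHk_tendsto_arc_cd {u ϰ x : ℝ} (hu : 0 ≤ u) (hx : 1 < x) :
    Tendsto (csHalfPlaneHk u ϰ) (𝓝[upperHalfPlaneSet] (x : ℂ)) (𝓝 ϰ) := by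
  have hα := tendsto_arg_sub_of_gt (r := 1 - u) (x := x) (by linarith)
  have hβ : Tendsto (fun z : ℂ ↦ arg z) (𝓝[upperHalfPlaneSet] (x : ℂ)) (𝓝 0) := by
    simpa using tendsto_arg_sub_of_gt (r := 0) (by linarith)
  have hγ : Tendsto (fun z : ℂ ↦ arg (z - 1)) (𝓝[upperHalfPlaneSet] (x : ℂ)) (𝓝 0) := by
    simpa using tendsto_arg_sub_of_gt (r := 1) hx
  convert tendsto_csHalfPlaneHk_of (by simpa using hα) hβ hγ using 2
  ring

/-- **Boundary values of `H_{u,ϰ}` on `(d a) = (-∞, 0)`: `ϰ`.**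
[cite: ChelkakSmirnov2012Ising, §6, proof of Thm. 6.1 (boundary values of the limit `H`)] -/
theorem csHalfPlaneHk_tendsto_arc_da {u ϰ x : ℝ} (hu : u ≤ 1) (hx : x < 0) :
    Tendsto (csHalfPlaneHk u ϰ) (𝓝[upperHalfPlaneSet] (x : ℂ)) (𝓝 ϰ) := by
  have hα := tendsto_arg_sub_of_lt (r := 1 - u) (x := x) (by linarith)
  have hβ : Tendsto (fun z : ℂ ↦ arg z) (𝓝[upperHalfPlaneSet] (x : ℂ)) (𝓝 Real.pi) := by
    simpa using tendsto_arg_sub_of_lt (r := 0) hx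
  have hγ : Tendsto (fun z : ℂ ↦ arg (z - 1)) (𝓝[upperHalfPlaneSet] (x : ℂ)) (𝓝 Real.pi) := by
    simpa using tendsto_arg_sub_of_lt (r := 1) (by linarith)
  convert tendsto_csHalfPlaneHk_of (by simpa using hα) hβ hγ using 2
  field_simp
  ring

/-- **Uniqueness: "`H = Im Φ`".** A bounded harmonic function `v` on `ℍ` with the boundary values
`0` on `(a b) = (0, 1-u)`, `1` on `(b c) = (1-u, 1)` and `ϰ` on `(c d) ∪ (d a) = (1, ∞) ∪ (-∞, 0)`,
outside a finite exceptional set of real points (nothing is assumed at the marked points nor at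
`d = ∞`), coincides with `H_{u,ϰ}` on `ℍ` (Lindelöf's maximum principle applied to `v - H_{u,ϰ}`).
[cite: ChelkakSmirnov2012Ising, §6, proof of Thm. 6.1 ("the imaginary part of Φ is harmonic and has
the same boundary values as H, so we conclude that H = Im Φ")] -/
theorem eq_csHalfPlaneHk_of_tendsto {u ϰ : ℝ} (hu : u ∈ Icc 0 1) (hϰ : ϰ ∈ Icc 0 1) {v : ℂ → ℝ}
    (hv : HarmonicOnNhd v upperHalfPlaneSet) {B : ℝ} (hB : ∀ z ∈ upperHalfPlaneSet, |v z| ≤ B)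
    (E : Finset ℝ)
    (h_ab : ∀ x : ℝ, x ∉ E → 0 < x → x < 1 - u → Tendsto v (𝓝[upperHalfPlaneSet] (x : ℂ)) (𝓝 0))
    (h_bc : ∀ x : ℝ, x ∉ E → 1 - u < x → x < 1 → Tendsto v (𝓝[upperHalfPlaneSet] (x : ℂ)) (𝓝 1))
    (h_cd : ∀ x : ℝ, x ∉ E → 1 < x → Tendsto v (𝓝[upperHalfPlaneSet] (x : ℂ)) (𝓝 ϰ))
    (h_da : ∀ x : ℝ, x ∉ E → x < 0 → Tendsto v (𝓝[upperHalfPlaneSet] (x : ℂ)) (𝓝 ϰ)) :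
    ∀ z ∈ upperHalfPlaneSet, v z = csHalfPlaneHk u ϰ z := by
  classical
  obtain ⟨hu0, hu1⟩ := hu
  set d : ℂ → ℝ := fun z ↦ v z - csHalfPlaneHk u ϰ z with hd
  have hd_harm : HarmonicOnNhd d upperHalfPlaneSet := hv.sub (csHalfPlaneHk_harmonicOnNhd u ϰ)
  have hd_bd : ∀ z ∈ upperHalfPlaneSet, |d z| ≤ B + 4 := fun z hz ↦ by
    have h1 := hB z hz
    have h2 := abs_csHalfPlaneHk_le (u := u) hϰ z
    exact (abs_sub _ _).trans (add_le_add h1 h2)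
  set E' : Finset ℝ := insert 0 (insert (1 - u) (insert 1 E)) with hE'
  have hd_lim : ∀ x : ℝ, x ∉ E' → Tendsto d (𝓝[upperHalfPlaneSet] (x : ℂ)) (𝓝 0) := by
    intro x hx
    simp only [hE', Finset.mem_insert, not_or] at hx
    obtain ⟨hx0, hxu, hx1, hxE⟩ := hx
    have aux : ∀ c : ℝ, Tendsto v (𝓝[upperHalfPlaneSet] (x : ℂ)) (𝓝 c) →
        Tendsto (csHalfPlaneHk u ϰ) (𝓝[upperHalfPlaneSet] (x : ℂ)) (𝓝 c) →
        Tendsto d (𝓝[upperHalfPlaneSet] (x : ℂ)) (𝓝 0) := fun c h1 h2 ↦ by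
      simpa [hd] using h1.sub h2
    rcases lt_or_gt_of_ne hx0 with hlt0 | hgt0
    · exact aux ϰ (h_da x hxE hlt0) (csHalfPlaneHk_tendsto_arc_da hu1 hlt0)
    rcases lt_or_gt_of_ne hxu with hltu | hgtu
    · exact aux 0 (h_ab x hxE hgt0 hltu) (csHalfPlaneHk_tendsto_arc_ab hu0 hgt0 hltu)
    rcases lt_or_gt_of_ne hx1 with hlt1 | hgt1
    · exact aux 1 (h_bc x hxE hgtu hlt1) (csHalfPlaneHk_tendsto_arc_bc hu1 hgtu hlt1)
    · exact aux ϰ (h_cd x hxE hgt1) (csHalfPlaneHk_tendsto_arc_cd hu0 hgt1)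
  intro z hz
  have := harmonic_eq_zero_of_tendsto_real_except hd_harm hd_bd E' hd_lim z hz
  simp only [hd] at this
  linarith

/-- **The lower bank: `ϰ > u` forces `H_{u,ϰ} < ϰ` near the part of `(c d) = (1, ∞)` close to
`d = ∞`** — in fact on the whole region `{Re z > 1, (ϰ-u) Re z > ϰ(1-u)}` of `ℍ` (the hypothesis
forces `ϰ > u`). [cite: ChelkakSmirnov2012Ising, §6, proof of Thm. 6.1 ("`d` is mapped, say, on the
lower bank of the cut. It means that `H < ϰ` near some (close to `d`) part of the boundary arc
`(c d)`"; and the degenerate cases `ϰ = 1`, `b = c` of p. 28)] -/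
theorem csHalfPlaneHk_lt_kappa {u ϰ : ℝ} (hu : u ∈ Icc 0 1) (hϰ : ϰ ∈ Icc 0 1)
    {z : ℂ} (hz : 0 < z.im) (h1 : 1 < z.re) (hX : ϰ * (1 - u) < (ϰ - u) * z.re) :
    csHalfPlaneHk u ϰ z < ϰ := by
  obtain ⟨hu0, hu1⟩ := hu
  have hp₁ : 0 < z.re - 1 := by linarith
  have hp₀ : 0 < z.re := by linarith
  have hq : 0 < z.re - 1 + u := by linarith
  have ha1 : arg (z - 1) = Real.arctan (z.im / (z.re - 1)) := by
    simpa using arg_sub_ofReal_eq_arctan (t := 1) (z := z) h1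
  have hau : arg (z - (1 - u : ℝ)) = Real.arctan (z.im / (z.re - 1 + u)) := by
    rw [arg_sub_ofReal_eq_arctan (by linarith)]
    congr 1
    ring
  have ha0 : arg z = Real.arctan (z.im / z.re) := by
    simpa using arg_sub_ofReal_eq_arctan (t := 0) (z := z) hp₀
  have hrat : (1 - ϰ) / (z.re - 1) + ϰ / z.re < 1 / (z.re - 1 + u) := by
    rw [div_add_div _ _ hp₁.ne' hp₀.ne', div_lt_div_iff₀ (mul_pos hp₁ hp₀) hq]
    have : ((1 - ϰ) * z.re + (z.re - 1) * ϰ) * (z.re - 1 + u) - 1 * ((z.re - 1) * z.re) =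
        (u - ϰ) * z.re + ϰ * (1 - u) := by ring
    nlinarith
  have hlin : (1 - ϰ) * (z.im / (z.re - 1)) + ϰ * (z.im / z.re) < z.im / (z.re - 1 + u) := by
    have e1 : (1 - ϰ) * (z.im / (z.re - 1)) + ϰ * (z.im / z.re) =
        z.im * ((1 - ϰ) / (z.re - 1) + ϰ / z.re) := by ring
    have e2 : z.im / (z.re - 1 + u) = z.im * (1 / (z.re - 1 + u)) := by ring
    rw [e1, e2]
    exact mul_lt_mul_of_pos_left hrat hz
  have key := weighted_arctan_lt hϰ (div_nonneg hz.le hp₁.le) (div_nonneg hz.le hp₀.le) hlin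
  unfold csHalfPlaneHk
  rw [ha1, hau, ha0]
  have hπ : 0 < Real.pi⁻¹ := inv_pos.2 Real.pi_pos
  nlinarith

/-- **The upper bank: `ϰ < u` forces `H_{u,ϰ} > ϰ` near the part of `(d a) = (-∞, 0)` close to
`d = ∞`** — on the whole region `{Re z < 0, (u-ϰ)(-Re z) > ϰ(1-u)}` of `ℍ` (the hypothesis forces
`ϰ < u`). [cite: ChelkakSmirnov2012Ising, §6, proof of Thm. 6.1 ("if `d` is mapped onto the upper
bank of the slit or `ϰ = 0`, then `H > ϰ` near some part of `(a d)`"; and the degenerate case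
`a = b` of p. 28)] -/
theorem kappa_lt_csHalfPlaneHk {u ϰ : ℝ} (hu : u ∈ Icc 0 1) (hϰ : ϰ ∈ Icc 0 1)
    {z : ℂ} (hz : 0 < z.im) (h0 : z.re < 0) (hX : ϰ * (1 - u) < (u - ϰ) * (-z.re)) :
    ϰ < csHalfPlaneHk u ϰ z := by
  obtain ⟨hu0, hu1⟩ := hu
  have hs0 : 0 < -z.re := by linarith
  have hp₁ : 0 < 1 - z.re := by linarith
  have hq : 0 < 1 - u - z.re := by linarith
  have ha1 : arg (z - 1) = Real.pi - Real.arctan (z.im / (1 - z.re)) := by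
    simpa using arg_sub_ofReal_eq_pi_sub_arctan (t := 1) (z := z) (by linarith) hz
  have hau : arg (z - (1 - u : ℝ)) = Real.pi - Real.arctan (z.im / (1 - u - z.re)) :=
    arg_sub_ofReal_eq_pi_sub_arctan (by linarith) hz
  have ha0 : arg z = Real.pi - Real.arctan (z.im / (-z.re)) := by
    simpa using arg_sub_ofReal_eq_pi_sub_arctan (t := 0) (z := z) h0 hz
  have hrat : (1 - ϰ) / (1 - z.re) + ϰ / (-z.re) < 1 / (1 - u - z.re) := by
    rw [div_add_div _ _ hp₁.ne' hs0.ne', div_lt_div_iff₀ (mul_pos hp₁ hs0) hq]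
    have : ((1 - ϰ) * (-z.re) + (1 - z.re) * ϰ) * (1 - u - z.re) - 1 * ((1 - z.re) * (-z.re)) =
        (ϰ - u) * (-z.re) + ϰ * (1 - u) := by ring
    nlinarith
  have hlin : (1 - ϰ) * (z.im / (1 - z.re)) + ϰ * (z.im / (-z.re)) < z.im / (1 - u - z.re) := by
    have e1 : (1 - ϰ) * (z.im / (1 - z.re)) + ϰ * (z.im / (-z.re)) =
        z.im * ((1 - ϰ) / (1 - z.re) + ϰ / (-z.re)) := by ring
    have e2 : z.im / (1 - u - z.re) = z.im * (1 / (1 - u - z.re)) := by ring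
    rw [e1, e2]
    exact mul_lt_mul_of_pos_left hrat hz
  have key := weighted_arctan_lt hϰ (div_nonneg hz.le hp₁.le) (div_nonneg hz.le hs0.le) hlin
  unfold csHalfPlaneHk
  rw [ha1, hau, ha0]
  have hπ : 0 < Real.pi⁻¹ := inv_pos.2 Real.pi_pos
  have hππ : Real.pi⁻¹ * Real.pi = 1 := inv_mul_cancel₀ Real.pi_pos.ne'
  nlinarith

/-- **"`d` is mapped to the tip" forces `ϰ = u`.** If `H_{u,ϰ}` is not eventually `< ϰ` towards
`d = ∞` along `(c d)` (for every `X` some `z ∈ ℍ` with `Re z > X` has `H_{u,ϰ}(z) ≥ ϰ`) and not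
eventually `> ϰ` towards `d` along `(d a)`, then `ϰ = u`; `u, ϰ ∈ [0, 1]`, the degenerate values
included. [cite: ChelkakSmirnov2012Ising, §6, proof of Thm. 6.1 ("Thus, `d` is mapped to the tip
and so `ϰ = ϰ(Ω; a, b, c, d)` is uniquely determined", `ϰ(ℍ; 0, 1-u, 1, ∞) = u`)] -/
theorem kappa_eq_of_tip {u ϰ : ℝ} (hu : u ∈ Icc 0 1) (hϰ : ϰ ∈ Icc 0 1)
    (hcd : ∀ X : ℝ, ∃ z : ℂ, 0 < z.im ∧ X < z.re ∧ ϰ ≤ csHalfPlaneHk u ϰ z)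
    (hda : ∀ X : ℝ, ∃ z : ℂ, 0 < z.im ∧ z.re < X ∧ csHalfPlaneHk u ϰ z ≤ ϰ) : ϰ = u := by
  by_contra hne
  rcases lt_or_gt_of_ne hne with hku | huk
  · -- `ϰ < u`: the upper bank
    obtain ⟨z, hz, hzre, hzH⟩ := hda (min 0 (-(1 + ϰ * (1 - u) / (u - ϰ))))
    have h0 : z.re < 0 := hzre.trans_le (min_le_left _ _)
    have h1 : 1 + ϰ * (1 - u) / (u - ϰ) < -z.re := by
      have := hzre.trans_le (min_le_right _ _); linarith
    have hX : ϰ * (1 - u) < (u - ϰ) * (-z.re) := by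
      have hpos : 0 < u - ϰ := by linarith
      have := mul_lt_mul_of_pos_left h1 hpos
      rw [mul_add, mul_one, mul_div_cancel₀ _ hpos.ne'] at this
      linarith
    exact absurd hzH (not_le.2 (kappa_lt_csHalfPlaneHk hu hϰ hz h0 hX))
  · -- `u < ϰ`: the lower bank
    obtain ⟨z, hz, hzre, hzH⟩ := hcd (max 1 (1 + ϰ * (1 - u) / (ϰ - u)))
    have h1 : 1 < z.re := (le_max_left _ _).trans_lt hzre
    have h2 : 1 + ϰ * (1 - u) / (ϰ - u) < z.re := (le_max_right _ _).trans_lt hzre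
    have hX : ϰ * (1 - u) < (ϰ - u) * z.re := by
      have hpos : 0 < ϰ - u := by linarith
      have := mul_lt_mul_of_pos_left h2 hpos
      rw [mul_add, mul_one, mul_div_cancel₀ _ hpos.ne'] at this
      linarith
    exact absurd hzH (not_le.2 (csHalfPlaneHk_lt_kappa hu hϰ hz h1 hX))

/-- From the local form of Rem. 6.3 on `(c d)` ("there is no point `ζ` of the arc such that
`H < ϰ` in a neighbourhood of `ζ`", i.e. `v ≥ ϰ` frequently at every real `x > 1`) to the form used
by `kappa_eq_of_tip`: for every `X` some `z ∈ ℍ` with `Re z > X` has `v z ≥ ϰ`.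
[cite: ChelkakSmirnov2012Ising, §6 Rem. 6.3] -/
theorem exists_re_gt_of_frequently_ge {v : ℂ → ℝ} {ϰ : ℝ}
    (h : ∀ x : ℝ, 1 < x → ∃ᶠ z in 𝓝[upperHalfPlaneSet] (x : ℂ), ϰ ≤ v z) (X : ℝ) :
    ∃ z : ℂ, 0 < z.im ∧ X < z.re ∧ ϰ ≤ v z := by
  set x : ℝ := max X 1 + 1 with hx
  have hx1 : 1 < x := by have := le_max_right X 1; linarith
  have hxX : X < x := by have := le_max_left X 1; linarith
  have hev : ∀ᶠ z in 𝓝[upperHalfPlaneSet] (x : ℂ), 0 < z.im ∧ X < z.re := by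
    have h1 : ∀ᶠ z in 𝓝[upperHalfPlaneSet] (x : ℂ), 0 < z.im :=
      eventually_mem_nhdsWithin.mono fun z hz ↦ hz
    have h2 : ∀ᶠ z in 𝓝 (x : ℂ), X < z.re :=
      (continuous_re.tendsto (x : ℂ)).eventually (Ioi_mem_nhds (by simpa using hxX))
    exact h1.and (h2.filter_mono nhdsWithin_le_nhds)
  obtain ⟨z, hz, hz'⟩ := ((h x hx1).and_eventually hev).exists
  exact ⟨z, hz'.1, hz'.2, hz⟩

/-- The same on `(d a) = (-∞, 0)` with the reversed inequality (there `H_{Γ*}` is superharmonic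
and the sign in Rem. 6.3 flips): `v ≤ ϰ` frequently at every real `x < 0` gives, for every `X`,
some `z ∈ ℍ` with `Re z < X` and `v z ≤ ϰ`. [cite: ChelkakSmirnov2012Ising, §6 Rem. 6.3] -/
theorem exists_re_lt_of_frequently_le {v : ℂ → ℝ} {ϰ : ℝ}
    (h : ∀ x : ℝ, x < 0 → ∃ᶠ z in 𝓝[upperHalfPlaneSet] (x : ℂ), v z ≤ ϰ) (X : ℝ) :
    ∃ z : ℂ, 0 < z.im ∧ z.re < X ∧ v z ≤ ϰ := by
  set x : ℝ := min X 0 - 1 with hx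
  have hx0 : x < 0 := by have := min_le_right X 0; linarith
  have hxX : x < X := by have := min_le_left X 0; linarith
  have hev : ∀ᶠ z in 𝓝[upperHalfPlaneSet] (x : ℂ), 0 < z.im ∧ z.re < X := by
    have h1 : ∀ᶠ z in 𝓝[upperHalfPlaneSet] (x : ℂ), 0 < z.im :=
      eventually_mem_nhdsWithin.mono fun z hz ↦ hz
    have h2 : ∀ᶠ z in 𝓝 (x : ℂ), z.re < X :=
      (continuous_re.tendsto (x : ℂ)).eventually (Iio_mem_nhds (by simpa using hxX))
    exact h1.and (h2.filter_mono nhdsWithin_le_nhds)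
  obtain ⟨z, hz, hz'⟩ := ((h x hx0).and_eventually hev).exists
  exact ⟨z, hz'.1, hz'.2, hz⟩

/-- **`ϰ(ℍ; 0, 1-u, 1, ∞) = u` (Chelkak–Smirnov), as a uniqueness theorem.** Let `v` be a bounded
harmonic function on `ℍ` with boundary values `0` on `(0, 1-u)`, `1` on `(1-u, 1)`, `ϰ` on
`(1, ∞) ∪ (-∞, 0)` outside a finite set of real points (`u, ϰ ∈ [0, 1]`), which is not eventually
`< ϰ` towards `d = ∞` along `(c d)` and not eventually `> ϰ` towards `d` along `(d a)` (the two
conclusions of the discrete argument of pp. 27–28, Rem. 6.3, transported to `ℍ`). Then `ϰ = u` and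
`v` is Chelkak–Smirnov's explicit `H = csHalfPlaneH u`. [cite: ChelkakSmirnov2012Ising, §6, proof of
Thm. 6.1 ("`d` is mapped to the tip … Hence, `ϰ(ℍ; 0, 1-u, 1, ∞) = u`")] -/
theorem kappa_eq_of_harmonic_boundary_values_of_tip {u ϰ : ℝ} (hu : u ∈ Icc 0 1)
    (hϰ : ϰ ∈ Icc 0 1) {v : ℂ → ℝ} (hv : HarmonicOnNhd v upperHalfPlaneSet) {B : ℝ}
    (hB : ∀ z ∈ upperHalfPlaneSet, |v z| ≤ B) (E : Finset ℝ)
    (h_ab : ∀ x : ℝ, x ∉ E → 0 < x → x < 1 - u → Tendsto v (𝓝[upperHalfPlaneSet] (x : ℂ)) (𝓝 0))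
    (h_bc : ∀ x : ℝ, x ∉ E → 1 - u < x → x < 1 → Tendsto v (𝓝[upperHalfPlaneSet] (x : ℂ)) (𝓝 1))
    (h_cd : ∀ x : ℝ, x ∉ E → 1 < x → Tendsto v (𝓝[upperHalfPlaneSet] (x : ℂ)) (𝓝 ϰ))
    (h_da : ∀ x : ℝ, x ∉ E → x < 0 → Tendsto v (𝓝[upperHalfPlaneSet] (x : ℂ)) (𝓝 ϰ))
    (tip_cd : ∀ X : ℝ, ∃ z : ℂ, 0 < z.im ∧ X < z.re ∧ ϰ ≤ v z)
    (tip_da : ∀ X : ℝ, ∃ z : ℂ, 0 < z.im ∧ z.re < X ∧ v z ≤ ϰ) :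
    ϰ = u ∧ ∀ z ∈ upperHalfPlaneSet, v z = csHalfPlaneH u z := by
  have hvH := eq_csHalfPlaneHk_of_tendsto hu hϰ hv hB E h_ab h_bc h_cd h_da
  have hk : ϰ = u := by
    refine kappa_eq_of_tip hu hϰ (fun X ↦ ?_) (fun X ↦ ?_)
    · obtain ⟨z, hz, hX, hzv⟩ := tip_cd X
      exact ⟨z, hz, hX, hvH z hz ▸ hzv⟩
    · obtain ⟨z, hz, hX, hzv⟩ := tip_da X
      exact ⟨z, hz, hX, hvH z hz ▸ hzv⟩
  refine ⟨hk, fun z hz ↦ ?_⟩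
  rw [hvH z hz, hk, csHalfPlaneHk_self]

end HalfPlane


/-! ### Geometry of the polygonal domain `Ω^δ`: compactness, openness, boundedness

The hypotheses `B(z₀, r) ⊆ Ω^δ ⊆ B(z₀, R)` of Thm. 6.1 and the Carathéodory compactness step of
its proof use that `Ω^δ = csDomain` is a bounded open set with compact closure inside the closed
polygon `csClosure` (a finite union of closed faces and half-rhombi). -/

namespace DiscreteRect

variable (E : Finset (Sym2 (Site 2))) (d₀ : Site 2 × Fin 4) (n : Fin 4 → ℕ)

/-- A closed face is compact. [folklore] -/
theorem isCompact_closedSq (δ : ℝ) (s : Site 2) : IsCompact (closedSq δ s) :=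
  (Set.finite_range _).isCompact_convexHull ℝ

/-- An outer half-rhombus is compact. [folklore] -/
theorem isCompact_outerHalfRhombus (δ : ℝ) (a : Site 2 × Fin 4) :
    IsCompact (outerHalfRhombus δ a) :=
  (Set.toFinite _).isCompact_convexHull ℝ

/-- A white half-rhombus is compact. [folklore] -/
theorem isCompact_whiteHalfRhombus (δ : ℝ) (d : Site 2 × Fin 4) :
    IsCompact (whiteHalfRhombus δ d) :=
  (Set.toFinite _).isCompact_convexHull ℝ

/-- **The closed polygon `csClosure` of a discrete quadrilateral is compact** (a finite union of
closed squares and triangles). [cite: ChelkakSmirnov2012Ising, §6 (the bounded polygonal domain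
`Ω^δ_◇`)] -/
theorem isCompact_csClosure (δ : ℝ) : IsCompact (csClosure E d₀ n δ) := by
  unfold csClosure
  exact ((Finset.isCompact_biUnion _ fun s _ ↦ isCompact_closedSq δ s).union
    (Finset.isCompact_biUnion _ fun a _ ↦ isCompact_outerHalfRhombus δ a)).union
    (Finset.isCompact_biUnion _ fun d _ ↦ isCompact_whiteHalfRhombus δ d)

/-- `csClosure` is closed. [folklore] -/
theorem isClosed_csClosure (δ : ℝ) : IsClosed (csClosure E d₀ n δ) :=
  (isCompact_csClosure E d₀ n δ).isClosed

/-- **The polygonal domain `Ω^δ = csDomain` is open.** [cite: ChelkakSmirnov2012Ising, §6] -/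
theorem isOpen_csDomain (δ : ℝ) : IsOpen (csDomain E d₀ n δ) :=
  isOpen_interior

/-- `Ω^δ ⊆ csClosure`. [folklore] -/
theorem csDomain_subset_csClosure (δ : ℝ) : csDomain E d₀ n δ ⊆ csClosure E d₀ n δ :=
  interior_subset

/-- **`Ω^δ` is bounded.** [cite: ChelkakSmirnov2012Ising, §6] -/
theorem isBounded_csDomain (δ : ℝ) : Bornology.IsBounded (csDomain E d₀ n δ) :=
  (isCompact_csClosure E d₀ n δ).isBounded.subset interior_subset

/-- The closure of `Ω^δ` lies in the closed polygon. [folklore] -/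
theorem closure_csDomain_subset (δ : ℝ) : closure (csDomain E d₀ n δ) ⊆ csClosure E d₀ n δ :=
  closure_minimal interior_subset (isClosed_csClosure E d₀ n δ)

/-- The closure of `Ω^δ` is compact. [folklore] -/
theorem isCompact_closure_csDomain (δ : ℝ) : IsCompact (closure (csDomain E d₀ n δ)) :=
  (isCompact_csClosure E d₀ n δ).of_isClosed_subset isClosed_closure
    (closure_csDomain_subset E d₀ n δ)

/-- The frontier of `Ω^δ` lies in the closed polygon. [folklore] -/
theorem frontier_csDomain_subset (δ : ℝ) : frontier (csDomain E d₀ n δ) ⊆ csClosure E d₀ n δ :=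
  frontier_subset_closure.trans (closure_csDomain_subset E d₀ n δ)

/-- The black arcs are compact. [folklore] -/
theorem isCompact_blackArc (δ : ℝ) (j : Fin 4) : IsCompact (blackArc E d₀ n δ j) :=
  Finset.isCompact_biUnion _ fun _ _ ↦ by
    rw [← convexHull_pair]
    exact (Set.toFinite _).isCompact_convexHull ℝ

/-- The white arcs are compact. [folklore] -/
theorem isCompact_whiteArc (δ : ℝ) (j : Fin 4) : IsCompact (whiteArc E d₀ n δ j) :=
  Finset.isCompact_biUnion _ fun _ _ ↦ by
    rw [← convexHull_pair]
    exact (Set.toFinite _).isCompact_convexHull ℝ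

end DiscreteRect


/-! ### Layer E: the compactness wrapper — reduction of Thm. 6.1 to its sequential form

The printed proof argues by contradiction along a sequence `δ → 0` ("Suppose that
`|P^δ(Ω^δ_◇) - p(Ω^δ)| ≥ ε₀ > 0` for some domains … with `δ → 0`. Passing to a subsequence … we may
assume that … `ϰ^δ → ϰ ∈ [0, 1]`"). Here is that wrapper, once and for all: the optimal
`ε(δ) = csEps r R t δ` (the supremum of the errors over the admissible configurations `CSConfig r R t`
at mesh `δ`) works as soon as the SEQUENTIAL statement holds (`chelkakSmirnov2012_of_seq`), and by
the half-plane uniqueness theorem of section `HalfPlane` the sequential statement in turn follows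
from the existence, along every admissible sequence with `δ_k → 0`, `P_k → P`, `η_k → η`, of a limiting
bounded harmonic function on `ℍ` with the boundary values `0 / 1 / ϰ / ϰ` (`ϰ = csKappa P`) for
`(0, 1-η, 1, ∞)` and the two tip conditions (`chelkakSmirnov2012_of_halfPlaneLimit`) — which is what
the layers not yet in the tree (the four-point observable, its precompactness and boundary values,
the discrete Green-formula argument of Rem. 6.3 and Carathéodory convergence) must deliver. -/

open Literature.Probability.RandomPlanarGeometry (ConformalEquiv crossRatio)
open Literature.Analysis.Potential (harmonicMeasure)

/-- The denominator `√(1-√u) + √(1-√(1-u))` of the crossing function is positive on all of `ℝ`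
(one of `√u`, `√(1-u)` is `< 1`). [folklore] -/
theorem fkIsingCrossingFunction_den_pos_real (u : ℝ) :
    0 < Real.sqrt (1 - Real.sqrt u) + Real.sqrt (1 - Real.sqrt (1 - u)) := by
  rcases le_or_gt u (1 / 2) with h | h
  · have h1 : Real.sqrt u < 1 := by
      rcases le_or_gt 0 u with hu | hu
      · calc Real.sqrt u ≤ Real.sqrt (1 / 2) := Real.sqrt_le_sqrt h
          _ < 1 := by
            rw [Real.sqrt_lt' one_pos]; norm_num
      · rw [Real.sqrt_eq_zero'.2 hu.le]; exact one_pos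
    exact add_pos_of_pos_of_nonneg (Real.sqrt_pos.2 (by linarith)) (Real.sqrt_nonneg _)
  · have h1 : Real.sqrt (1 - u) < 1 := by
      rcases le_or_gt 0 (1 - u) with hu | hu
      · calc Real.sqrt (1 - u) ≤ Real.sqrt (1 / 2) := Real.sqrt_le_sqrt (by linarith)
          _ < 1 := by
            rw [Real.sqrt_lt' one_pos]; norm_num
      · rw [Real.sqrt_eq_zero'.2 hu.le]; exact one_pos
    exact add_pos_of_nonneg_of_pos (Real.sqrt_nonneg _) (Real.sqrt_pos.2 (by linarith))

/-- **The crossing function `p = fkIsingCrossingFunction` is continuous** (on all of `ℝ`: its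
denominator never vanishes). [cite: ChelkakSmirnov2012Ising, Thm. 6.1 eq. (6.1)] -/
theorem continuous_fkIsingCrossingFunction : Continuous fkIsingCrossingFunction := by
  unfold fkIsingCrossingFunction
  exact Continuous.div (by fun_prop) (by fun_prop) fun u ↦ (fkIsingCrossingFunction_den_pos_real u).ne'

/-- **An admissible configuration of Thm. 6.1** for the parameters `r, R, t`: a mesh `δ > 0`, a
square-lattice discrete quadrilateral `(E, d₀, n)`, a base point `z₀` with
`B(z₀, r) ⊆ Ω^δ ⊆ B(z₀, R)` and no neighbouring small arcs (harmonic measures `≥ t`), and a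
conformal map `φ : ℍ → Ω^δ` with boundary values the four marked corners at the real points
`x₀, x₁, x₂, x₃` (monotone) — exactly the data and hypotheses quantified in
`ChelkakSmirnov2012_fkIsingQuadrilateralCrossing`, bundled for the compactness argument.
[cite: ChelkakSmirnov2012Ising, Thm. 6.1 (hypotheses)] -/
structure CSConfig (r R t : ℝ) where
  /-- the mesh -/
  δ : ℝ
  /-- the edge set of the discrete domain -/
  E : Finset (Sym2 (Site 2))
  /-- the initial external dart of the boundary trace -/
  d₀ : Site 2 × Fin 4
  /-- the lengths of the four arcs -/
  n : Fin 4 → ℕ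
  /-- the base point -/
  z₀ : ℂ
  /-- the real preimages of the four corners -/
  x : Fin 4 → ℝ
  /-- the uniformizing map `ℍ → Ω^δ` -/
  φ : ConformalEquiv UpperHalfPlane.upperHalfPlaneSet (DiscreteRect.csDomain E d₀ n δ)
  δ_pos : 0 < δ
  quad : DiscreteRect.IsCSQuadrilateral E d₀ n
  ball_subset : Metric.ball z₀ r ⊆ DiscreteRect.csDomain E d₀ n δ
  subset_ball : DiscreteRect.csDomain E d₀ n δ ⊆ Metric.ball z₀ R
  arcs : (t ≤ harmonicMeasure (DiscreteRect.csDomain E d₀ n δ) z₀ (DiscreteRect.blackArc E d₀ n δ 0) ∧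
      t ≤ harmonicMeasure (DiscreteRect.csDomain E d₀ n δ) z₀ (DiscreteRect.blackArc E d₀ n δ 2) ∨
    t ≤ harmonicMeasure (DiscreteRect.csDomain E d₀ n δ) z₀ (DiscreteRect.whiteArc E d₀ n δ 1) ∧
      t ≤ harmonicMeasure (DiscreteRect.csDomain E d₀ n δ) z₀ (DiscreteRect.whiteArc E d₀ n δ 3))
  mono : StrictMono x ∨ StrictAnti x
  boundaryValue : ∀ j : Fin 4, φ.HasBoundaryValue (x j) (meshPoint δ (DiscreteRect.csCorner E d₀ n j))

namespace CSConfig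

variable {r R t : ℝ}

/-- The crossing probability `P^δ` of the configuration. [cite: ChelkakSmirnov2012Ising, §6 (P^δ)] -/
def P (c : CSConfig r R t) : ℝ := DiscreteRect.csCrossingProb c.E c.d₀ c.n

/-- The conformal modulus (Cardy's cross-ratio) `η = crossRatio x` of the configuration.
[cite: ChelkakSmirnov2012Ising, Thm. 6.1 ("p depends only on the conformal modulus")] -/
def η (c : CSConfig r R t) : ℝ := crossRatio c.x

/-- The error `|P^δ - p(η)|` of the configuration. [cite: ChelkakSmirnov2012Ising, Thm. 6.1] -/
def err (c : CSConfig r R t) : ℝ := |c.P - fkIsingCrossingFunction c.η|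

/-- `P^δ ∈ [0, 1]`. [folklore] -/
theorem P_mem_Icc (c : CSConfig r R t) : c.P ∈ Icc 0 1 :=
  DiscreteRect.csCrossingProb_mem_Icc _ _ _

/-- The error is non-negative. [folklore] -/
theorem err_nonneg (c : CSConfig r R t) : 0 ≤ c.err := abs_nonneg _

/-- The error is at most `1`. [folklore] -/
theorem err_le_one (c : CSConfig r R t) : c.err ≤ 1 :=
  DiscreteRect.abs_csCrossingProb_sub_fkIsingCrossingFunction_le_one _ _ _ _

/-- `η ∈ [0, 1]` (indeed in `(0, 1)`, the `x j` being strictly monotone). [folklore] -/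
theorem η_mem_Icc (c : CSConfig r R t) : c.η ∈ Icc 0 1 :=
  Ioo_subset_Icc_self (Literature.Probability.RandomPlanarGeometry.crossRatio_mem_Ioo c.mono)

end CSConfig

variable {r R t : ℝ}

/-- The set of errors realised at mesh `δ` (with `0` adjoined, so that it is non-empty). [folklore] -/
def csErrSet (r R t δ : ℝ) : Set ℝ :=
  insert 0 {e | ∃ c : CSConfig r R t, c.δ = δ ∧ c.err = e}

/-- **The optimal `ε(δ) = ε(δ, r, R, t)`**: the supremum of the errors `|P^δ - p(η)|` over all
admissible configurations at mesh `δ` (and `0`). [cite: ChelkakSmirnov2012Ising, Thm. 6.1 (ε(δ, r, R, t))] -/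
def csEps (r R t δ : ℝ) : ℝ := sSup (csErrSet r R t δ)

/-- The error set is non-empty. [folklore] -/
theorem csErrSet_nonempty (r R t δ : ℝ) : (csErrSet r R t δ).Nonempty := ⟨0, mem_insert _ _⟩

/-- The error set is bounded above by `1`. [folklore] -/
theorem csErrSet_bddAbove (r R t δ : ℝ) : BddAbove (csErrSet r R t δ) := by
  refine ⟨1, fun e he ↦ ?_⟩
  rcases he with rfl | ⟨c, -, rfl⟩
  · exact zero_le_one
  · exact c.err_le_one

/-- Every admissible configuration has error `≤ ε(δ)`. [folklore] -/
theorem err_le_csEps (c : CSConfig r R t) : c.err ≤ csEps r R t c.δ :=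
  le_csSup (csErrSet_bddAbove r R t c.δ) (Or.inr ⟨c, rfl, rfl⟩)

/-- `ε(δ) ≥ 0`. [folklore] -/
theorem csEps_nonneg (r R t δ : ℝ) : 0 ≤ csEps r R t δ :=
  le_csSup (csErrSet_bddAbove r R t δ) (mem_insert _ _)

/-- Below the supremum there is a configuration. [folklore] -/
theorem exists_config_of_lt_csEps {r R t δ e : ℝ} (he : 0 ≤ e) (h : e < csEps r R t δ) :
    ∃ c : CSConfig r R t, c.δ = δ ∧ e < c.err := by
  obtain ⟨v, hv, hev⟩ := exists_lt_of_lt_csSup (csErrSet_nonempty r R t δ) h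
  rcases hv with rfl | ⟨c, hc, rfl⟩
  · exact absurd hev (not_lt.2 he)
  · exact ⟨c, hc, hev⟩

/-- **Reduction of Thm. 6.1 to its sequential form** (the opening of the printed proof: "Suppose
that `|P^δ(Ω^δ) - p(Ω^δ)| ≥ ε₀ > 0` for some domains with `δ → 0`. Passing to a subsequence, we may
assume that … `ϰ^δ → ϰ`"): it suffices to show that along every SEQUENCE of admissible
configurations with `δ_k → 0` whose crossing probabilities `P_k` and moduli `η_k` converge, the
limits satisfy `P_∞ = p(η_∞)`. The optimal `ε(δ)` is `csEps`; compactness of `[0, 1]` supplies the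
convergent subsequences and the continuity of `p` concludes.
[cite: ChelkakSmirnov2012Ising, §6, proof of Thm. 6.1 (first paragraph after (6.7))] -/
theorem chelkakSmirnov2012_of_seq
    (h : ∀ r R t : ℝ, 0 < r → 0 < R → 0 < t → ∀ c : ℕ → CSConfig r R t,
      Tendsto (fun k ↦ (c k).δ) atTop (𝓝 0) → ∀ P η : ℝ,
      Tendsto (fun k ↦ (c k).P) atTop (𝓝 P) → Tendsto (fun k ↦ (c k).η) atTop (𝓝 η) →
      P = fkIsingCrossingFunction η) :
    ChelkakSmirnov2012_fkIsingQuadrilateralCrossing := by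
  intro r R t hr hR ht
  refine ⟨csEps r R t, ?_, ?_⟩
  · -- `ε(δ) → 0`, by contradiction
    by_contra hnot
    obtain ⟨e, he, hfreq⟩ : ∃ e : ℝ, 0 < e ∧ ∃ᶠ δ in 𝓝[>] (0 : ℝ), e ≤ csEps r R t δ := by
      by_contra hall
      push Not at hall
      apply hnot
      rw [Metric.tendsto_nhds]
      intro e he
      filter_upwards [hall e he] with δ hδ
      rwa [Real.dist_eq, sub_zero, abs_of_nonneg (csEps_nonneg r R t δ)]
    -- a sequence `δ_k → 0`, `δ_k > 0`, with `ε(δ_k) ≥ e`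
    have hfreq' : ∃ᶠ δ in 𝓝[>] (0 : ℝ), 0 < δ ∧ e ≤ csEps r R t δ :=
      (hfreq.and_eventually eventually_mem_nhdsWithin).mono fun δ ⟨h1, h2⟩ ↦ ⟨h2, h1⟩
    obtain ⟨δs, hδs, hδs'⟩ := Filter.exists_seq_forall_of_frequently hfreq'
    -- configurations at these meshes with error `> e/2`
    have hc : ∀ k, ∃ c : CSConfig r R t, c.δ = δs k ∧ e / 2 < c.err := fun k ↦
      exists_config_of_lt_csEps (by linarith) (by linarith [(hδs' k).2])
    choose c hcδ hce using hc
    -- compactness of `[0, 1]`: a subsequence along which `P_k` and `η_k` converge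
    obtain ⟨P, -, φ₁, hφ₁, hP⟩ := tendsto_subseq_of_bounded (Metric.isBounded_Icc (0 : ℝ) 1)
      (x := fun k ↦ (c k).P) (fun k ↦ (c k).P_mem_Icc)
    obtain ⟨η, -, φ₂, hφ₂, hη⟩ := tendsto_subseq_of_bounded (Metric.isBounded_Icc (0 : ℝ) 1)
      (x := fun k ↦ (c (φ₁ k)).η) (fun k ↦ (c (φ₁ k)).η_mem_Icc)
    -- the sequential hypothesis along `c ∘ φ₁ ∘ φ₂`
    have hδ0 : Tendsto (fun k ↦ (c (φ₁ (φ₂ k))).δ) atTop (𝓝 0) := by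
      have h0 : Tendsto δs atTop (𝓝 0) := hδs.mono_right nhdsWithin_le_nhds
      have := (h0.comp hφ₁.tendsto_atTop).comp hφ₂.tendsto_atTop
      simpa [Function.comp_def, hcδ] using this
    have hPP : Tendsto (fun k ↦ (c (φ₁ (φ₂ k))).P) atTop (𝓝 P) := hP.comp hφ₂.tendsto_atTop
    have hηη : Tendsto (fun k ↦ (c (φ₁ (φ₂ k))).η) atTop (𝓝 η) := hη
    have key := h r R t hr hR ht (fun k ↦ c (φ₁ (φ₂ k))) hδ0 P η hPP hηη
    -- the errors along the subsequence tend to `|P - p(η)| = 0` …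
    have herr : Tendsto (fun k ↦ (c (φ₁ (φ₂ k))).err) atTop
        (𝓝 |P - fkIsingCrossingFunction η|) :=
      (hPP.sub ((continuous_fkIsingCrossingFunction.tendsto η).comp hηη)).abs
    rw [key, sub_self, abs_zero] at herr
    -- … but they all exceed `e/2 > 0`
    obtain ⟨k, hk⟩ := (herr.eventually (Iio_mem_nhds (by linarith : (0 : ℝ) < e / 2))).exists
    exact absurd (hce (φ₁ (φ₂ k))) (not_lt.2 (le_of_lt hk))
  · intro δ E d₀ n z₀ hδ hq U hball hsub harcs φ x hmono hbv
    exact err_le_csEps (⟨δ, E, d₀, n, z₀, x, φ, hδ, hq, hball, hsub, harcs, hmono, hbv⟩ : CSConfig r R t)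


open UpperHalfPlane (upperHalfPlaneSet) in
open InnerProductSpace (HarmonicOnNhd) in
/-- **Reduction of Thm. 6.1 to the existence of the limiting harmonic function on `ℍ`.** Suppose
that along every sequence of admissible configurations with `δ_k → 0`, `P_k → P` and `η_k → η` there
is a bounded harmonic function `v` on `ℍ` with boundary values `0` on `(0, 1-η)`, `1` on `(1-η, 1)`,
`ϰ := csKappa P` on `(1, ∞) ∪ (-∞, 0)` off a finite set of real points, which is not eventually `< ϰ`
towards `∞` along `(1, ∞)` nor eventually `> ϰ` towards `∞` along `(-∞, 0)` (in the printed proof: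
`v = lim H^δ` transported to `ℍ`, its boundary values (p. 27) and the conclusions of the discrete
Green-formula argument, Rem. 6.3). Then Thm. 6.1 holds: `ϰ = η` by
`kappa_eq_of_harmonic_boundary_values_of_tip`, so `P = ξ⁻¹(η) = p(η)`, and `chelkakSmirnov2012_of_seq`
applies. [cite: ChelkakSmirnov2012Ising, §6, proof of Thm. 6.1 (structure of the argument)] -/
theorem chelkakSmirnov2012_of_halfPlaneLimit
    (h : ∀ r R t : ℝ, 0 < r → 0 < R → 0 < t → ∀ c : ℕ → CSConfig r R t,
      Tendsto (fun k ↦ (c k).δ) atTop (𝓝 0) → ∀ P η : ℝ,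
      Tendsto (fun k ↦ (c k).P) atTop (𝓝 P) → Tendsto (fun k ↦ (c k).η) atTop (𝓝 η) →
      ∃ (v : ℂ → ℝ) (B : ℝ) (T : Finset ℝ), HarmonicOnNhd v upperHalfPlaneSet ∧
        (∀ z ∈ upperHalfPlaneSet, |v z| ≤ B) ∧
        (∀ x : ℝ, x ∉ T → 0 < x → x < 1 - η → Tendsto v (𝓝[upperHalfPlaneSet] (x : ℂ)) (𝓝 0)) ∧
        (∀ x : ℝ, x ∉ T → 1 - η < x → x < 1 → Tendsto v (𝓝[upperHalfPlaneSet] (x : ℂ)) (𝓝 1)) ∧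
        (∀ x : ℝ, x ∉ T → 1 < x → Tendsto v (𝓝[upperHalfPlaneSet] (x : ℂ)) (𝓝 (csKappa P))) ∧
        (∀ x : ℝ, x ∉ T → x < 0 → Tendsto v (𝓝[upperHalfPlaneSet] (x : ℂ)) (𝓝 (csKappa P))) ∧
        (∀ X : ℝ, ∃ z : ℂ, 0 < z.im ∧ X < z.re ∧ csKappa P ≤ v z) ∧
        (∀ X : ℝ, ∃ z : ℂ, 0 < z.im ∧ z.re < X ∧ v z ≤ csKappa P)) :
    ChelkakSmirnov2012_fkIsingQuadrilateralCrossing := by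
  refine chelkakSmirnov2012_of_seq fun r R t hr hR ht c hδ P η hP hη ↦ ?_
  have hPI : P ∈ Icc 0 1 :=
    isClosed_Icc.mem_of_tendsto hP (Eventually.of_forall fun k ↦ (c k).P_mem_Icc)
  have hηI : η ∈ Icc 0 1 :=
    isClosed_Icc.mem_of_tendsto hη (Eventually.of_forall fun k ↦ (c k).η_mem_Icc)
  have hϰI : csKappa P ∈ Icc 0 1 := by
    have hm := csKappa_strictMonoOn.monotoneOn
    refine ⟨?_, ?_⟩
    · simpa [csKappa_zero] using hm (left_mem_Icc.2 zero_le_one) hPI hPI.1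
    · simpa [csKappa_one] using hm hPI (right_mem_Icc.2 zero_le_one) hPI.2
  obtain ⟨v, B, T, hv, hB, h_ab, h_bc, h_cd, h_da, tip_cd, tip_da⟩ := h r R t hr hR ht c hδ P η hP hη
  have hk := (kappa_eq_of_harmonic_boundary_values_of_tip hηI hϰI hv hB T h_ab h_bc h_cd h_da
    tip_cd tip_da).1
  exact eq_fkIsingCrossingFunction_of_csKappa_eq hPI hηI hk


/-! #### `ϰ = csKappa` is continuous; `ϰ_k → ϰ` along admissible sequences -/

/-- **`ϰ = ξ(P)` is continuous** (on all of `ℝ`: the common denominator of `A^δ`, `C^δ` at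
`(P, 1 - P)` never vanishes). [cite: ChelkakSmirnov2012Ising, §6 eq. (6.7)] -/
theorem continuous_csKappa : Continuous csKappa := by
  have hden : ∀ P : ℝ, P * (Real.sqrt 2 * P + (1 - P)) + (1 - P) * (P + Real.sqrt 2 * (1 - P)) ≠ 0 :=
    fun P ↦ (csDen_pos (P := P) (Q := 1 - P) (by
      by_cases h : P = 0
      · exact Or.inr (by rw [h]; norm_num)
      · exact Or.inl h)).ne'
  have h : Continuous fun P : ℝ ↦ csA P (1 - P) := by
    unfold csA
    exact Continuous.div (by fun_prop) (by fun_prop) hden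
  show Continuous fun P : ℝ ↦ csA P (1 - P) ^ 2
  exact h.pow 2

namespace CSConfig

variable {r R t : ℝ}

/-- **`ϰ^δ = ξ(P^δ)`** of the configuration, the common boundary value of `H^δ` on `(c d) ∪ (d a)`
(eq. (6.6)). [cite: ChelkakSmirnov2012Ising, §6 eq. (6.7)] -/
def ϰ (c : CSConfig r R t) : ℝ := csKappa c.P

/-- `ϰ^δ ∈ [0, 1]`. [cite: ChelkakSmirnov2012Ising, §6 (ϰ^δ → ϰ ∈ [0, 1])] -/
theorem ϰ_mem_Icc (c : CSConfig r R t) : c.ϰ ∈ Icc 0 1 := csKappa_mem_Icc c.P_mem_Icc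

/-- Along an admissible sequence with `P_k → P`, `ϰ_k → ξ(P)` ("`ϰ^δ → ϰ`", the boundary value
of the limiting `H` on `(c d) ∪ (d a)`). [cite: ChelkakSmirnov2012Ising, §6, proof of Thm. 6.1] -/
theorem tendsto_ϰ {c : ℕ → CSConfig r R t} {P : ℝ} (hP : Tendsto (fun k ↦ (c k).P) atTop (𝓝 P)) :
    Tendsto (fun k ↦ (c k).ϰ) atTop (𝓝 (csKappa P)) :=
  (continuous_csKappa.tendsto P).comp hP

/-- The domain `Ω^δ` of a configuration contains its base point. [folklore] -/
theorem z₀_mem (hr : 0 < r) (c : CSConfig r R t) : c.z₀ ∈ DiscreteRect.csDomain c.E c.d₀ c.n c.δ :=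
  c.ball_subset (Metric.mem_ball_self hr)

/-- A subsequence of admissible configurations (reindexing). [folklore] -/
theorem tendsto_δ_comp {c : ℕ → CSConfig r R t} (hδ : Tendsto (fun k ↦ (c k).δ) atTop (𝓝 0))
    {σ : ℕ → ℕ} (hσ : StrictMono σ) : Tendsto (fun k ↦ (c (σ k)).δ) atTop (𝓝 0) :=
  hδ.comp hσ.tendsto_atTop

end CSConfig

end Literature.Probability.LatticeModels

end
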